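import Literature.MathematicalPhysics.QuantumLattice.FermionOperatorsProofs
import Literature.MathematicalPhysics.QuantumLattice.FinDimSpectrumProofs
import HarnessLib

/-!
# Barrier: degree-4 sum of squares (the `2`-RDM level) does not reproduce second-order perturbation theory for quartic fermion Hamiltonians (Hastings 2022, §2.1)

Barrier catalogue `Literature/Barriers/HubbardSuperconductivity/` (D-0021), entry
`DegreeFourSosMissesSecondOrderPerturbation`, for the summit `HubbardSuperconductivity` and its
certified-numerics programmes (ladder `HubbardLadder`, `hubbard-alg`: certified two-sided windows on
ground-state energies of Hubbard-type quartic fermion Hamiltonians from semidefinite relaxations —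
moment / sum-of-squares hierarchies, reduced-density-matrix `N`-representability conditions).

## What is vendored (as printed)

M. B. Hastings, *Perturbation Theory and the Sum of Squares*, arXiv:2205.12325 (2022)
(`Hastings2022`, held as `paper:arxiv-2205.12325`; read 2026-08-23, §§1, 2.1, 2.2):

* Abstract, verbatim: "For such fermionic systems, we show that degree-4 SoS (called 2-RDM in quantum
  chemistry) does not reproduce second order perturbation theory but degree-6 SoS (3-RDM) does (and
  we conjecture that it reproduces third order perturbation theory). Indeed, we identify a fragment of
  degree-6 SoS which can do this".
* §1, verbatim: "We say that a given degree of SoS reproduces the k-th order of perturbation theory if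
  the lower bound on the ground state energy computed by that degree of SoS agrees with the exact ground
  state energy up to terms which are o(J^k)"; "We find that in general, for fermions with quartic
  interactions, degree-4 SoS is not able to reproduce the results of second order perturbation theory".
* §2.1.1 (the example, particle–hole frame, eq. (Hph)): seven modes `0` and `(i,a)`, `i ∈ {1,2,3}`,
  `a ∈ {1,2}`; `H = ψ†_0ψ_0 + Σ_{a,i} ψ†_{i,a}ψ_{i,a} + ε Σ_a (ψ†_0ψ†_{1,a}ψ†_{2,a}ψ†_{3,a} + h.c.)`;
  "the ground state energy is equal to `E₀ = -½ε² + O(ε⁴)`"; the degree-4 pseudo-expectation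
  `Ẽ[ψ†_0ψ_0] = Ẽ[ψ†_{i,a}ψ_{i,a}] = u`, `Ẽ[n_0 n_{i,a}] = Ẽ[n_{i,a}n_{j,b}] = u`,
  `Ẽ[ψ†_0ψ†_{1,a}ψ†_{2,a}ψ†_{3,a}] = v`, all other normal-ordered words zero; "it reduces to showing
  positive semi-definiteness of the two-by-two matrix `[[1-u, v],[v, u]]`. Taking `v` small and taking
  `u = v² + O(v⁴)` gives a positive-semi-definite matrix"; "`Ẽ[H] = 4εv + 7u`"; "Optimizing over `v`,
  taking `v = -2ε/7 + O(ε³)`, we have `Ẽ[H] = -(4/7)ε² + O(ε⁴)`, and since `4/7 > 1/2`, this does not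
  agree with the exact second order result."
* §2.2 (the evasion), verbatim: "We now show that degree-6 SoS does reproduce second order perturbation
  theory"; Abstract: "a fragment of degree-6 SoS which can do this, which may be useful for practical
  quantum chemical calculations".

## Lean rendering (everything PROVED; no named fact is introduced)

* CAR algebra = the tree's Jordan–Wigner matrices `creation`, `annihilation` on `Fock ι = (Finset ι → ℂ)`
  (`HubbardWave0`, `FermionOperators{,Proofs}`), modes `Mode = Fin 7` (`0 ↦ 0`, `(i,a) ↦ 3(a-1)+i`).
* `DegreeFourSos.poly₂ c` = a polynomial of degree `≤ 2` in the generators (coefficients on the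
  redundant spanning family `1, g, g g'`); `IsDegreeFourPseudoExpectation E` = `E 1 = 1`,
  `E X† = conj E X`, `0 ≤ E (O†O)` for all such `O`; `IsDegreeFourSosCertificate H λ` =
  `H - λ·1 = Σ_j O_j†O_j`, `deg O_j ≤ 2` (in the faithful matrix representation, so the CAR are built in);
  weak duality `sosCertificate_le_pseudoExpectation`.
* `DegreeFourSos.hamiltonian ε` = eq. (Hph); `pseudoE u v` = `X ↦ Tr(ρ̃ X)` with the explicit
  non-positive `ρ̃ = (1-u)|∅⟩⟨∅| + u|F⟩⟨F| + v Σ_a (|Q_a⟩⟨∅| + |∅⟩⟨Q_a|)` (agrees with the printed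
  assignment on every normal-ordered word of degree `≤ 4`); `pseudoE_hamiltonian : Ẽ[H_ε] = 7u + 4εv`;
  parameters `vOf ε = -2ε/7`, `uOf ε = v² + 2v⁴` (an explicit realisation of the printed `O(·)` choices),
  `pseudoE_hamiltonian_val : Ẽ[H_ε] = -(4/7)ε² + (32/343)ε⁴`.
* Degree-4 positivity (`pseudoE_conjTranspose_mul_self_nonneg`): particle-number grading of Fock space
  (`SuppCard`, `cq`, `cross_term_eq`: only the `ψψ`-part on `Ψ_a` against the `ψ†ψ†`-part on the vacuum
  sees `v`), the trilinear annihilator `D_a` of the other quartet's private modes (`β_a = ± D_a γ`,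
  `D_a†D_a` = a projection), two Cauchy–Schwarz inequalities, and the printed `2 × 2` positivity
  (`two_by_two_nonneg`).
* Lower bound (`hamiltonian_add_posSemidef`): `H_ε + (ε²/2)·1 = Σ_a (T_{a,1}†T_{a,1} + T_{a,2}†T_{a,2}) +
  diag(d)`, `d ≥ 0` — an explicit operator inequality for `0 ≤ ε ≤ 1` replacing the exact `3 × 3`
  block diagonalisation of print (`E₀ = 2 - √(4 + 2ε²) ≥ -ε²/2`); the `2⁷` diagonal entries are checked by
  `decide` on an `ε`-free integer inequality (`indI_add_min_indJ_nonneg`).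
* The barrier `DegreeFourSosMissesSecondOrderPerturbation` and `_holds`; corollary
  `degreeFour_certificate_gap : λ + (ε²/14 - (32/343)ε⁴) ≤ E₀(H_ε)` for every degree-4 certificate `λ`.

Related tree files (not imported): the fixed-`N` `2`-RDM relaxation with the `D, Q, G` conditions,
`Literature/MathematicalPhysics/QuantumChemistry/VariationalRDMRelaxation.lean`
(`le_groundEnergy_of_forall_isDQGFeasible`), and its `T1, T2′` strengthening
`ThreeIndexRelaxationBound.lean` (`le_groundEnergy_of_forall_isDQGT1T2PrimeFeasible`) — the latter is
the quantum-chemistry form of the degree-6 fragment of §2.2.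

## References

* [Hastings2022] M. B. Hastings, *Perturbation Theory and the Sum of Squares*, arXiv:2205.12325,
  §1, §2.1 (eqs. (Horig), (Hph), (Qdef)), §2.1.1, §2.1.2, §2.2.
-/

noncomputable section

namespace Literature.Barriers.HubbardSuperconductivity

open Matrix Finset Literature.MathematicalPhysics.QuantumLattice
open scoped ComplexOrder

namespace DegreeFourSos

/-! ### Degree-≤2 polynomials in the CAR generators and degree-4 pseudo-expectations -/

section CAR

variable {ι : Type*} [LinearOrder ι] [Fintype ι]

/-- A generator of the CAR algebra over the mode set `ι`: `c†_m` (`(m, true)`) or `c_m`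
(`(m, false)`), as Jordan–Wigner matrices on the fermionic Fock space `ℓ²(Finset ι)`.
[cite: Hastings2022, §2.1.1] -/
def gen (γ : ι × Bool) : Matrix (Finset ι) (Finset ι) ℂ :=
  if γ.2 then creation γ.1 else annihilation γ.1

/-- Index set of the monomials of degree `≤ 2` in the generators: the empty word, a generator,
or an ordered pair of generators. [cite: Hastings2022, §1 (degree-2T pseudo-expectations)] -/
abbrev MonoIdx (ι : Type*) : Type _ := Option ((ι × Bool) ⊕ ((ι × Bool) × (ι × Bool)))

/-- The monomial of degree `≤ 2` with a given index. [cite: Hastings2022, §2.1.1] -/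
def mono : MonoIdx ι → Matrix (Finset ι) (Finset ι) ℂ
  | none => 1
  | some (Sum.inl γ) => gen γ
  | some (Sum.inr p) => gen p.1 * gen p.2

/-- A polynomial of degree `≤ 2` in the creation/annihilation operators, given by its
coefficients on the (redundant) spanning family `mono`. [cite: Hastings2022, §2.1.1] -/
def poly₂ (c : MonoIdx ι → ℂ) : Matrix (Finset ι) (Finset ι) ℂ := ∑ i, c i • mono i

/-- **Degree-4 pseudo-expectation** (the dual object of degree-4 = "2-RDM" sum-of-squares):
a linear functional `Ẽ` on the operator algebra with `Ẽ[1] = 1`, `Ẽ[X†] = conj Ẽ[X]`, and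
`Ẽ[O†O] ≥ 0` for every polynomial `O` of degree at most `2` in the creation and annihilation
operators ("We must show `Ẽ[O†O] ≥ 0` for any operator `O` which is of degree at most 2").
[cite: Hastings2022, §1 and §2.1.1] -/
def IsDegreeFourPseudoExpectation (E : Matrix (Finset ι) (Finset ι) ℂ →ₗ[ℂ] ℂ) : Prop :=
  E 1 = 1 ∧ (∀ X, E Xᴴ = star (E X)) ∧ ∀ c : MonoIdx ι → ℂ, 0 ≤ E ((poly₂ c)ᴴ * poly₂ c)

/-- **Degree-4 sum-of-squares certificate** for the lower bound `λ` on `H`: an identity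
`H - λ·1 = Σ_j O_j† O_j` in the CAR algebra (here: its faithful Jordan–Wigner matrix
representation, so the anticommutation relations are built in) with every `O_j` of degree `≤ 2`.
[cite: Hastings2022, §1] -/
def IsDegreeFourSosCertificate (H : Matrix (Finset ι) (Finset ι) ℂ) (lam : ℝ) : Prop :=
  ∃ (k : ℕ) (c : Fin k → MonoIdx ι → ℂ),
    H - (lam : ℂ) • (1 : Matrix (Finset ι) (Finset ι) ℂ) = ∑ j, (poly₂ (c j))ᴴ * poly₂ (c j)

/-- Weak duality: a degree-4 SoS certificate for `λ` forces `λ ≤ Ẽ[H]` for every degree-4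
pseudo-expectation `Ẽ` (apply `Ẽ` to the certificate). [cite: Hastings2022, §1] -/
theorem sosCertificate_le_pseudoExpectation {H : Matrix (Finset ι) (Finset ι) ℂ} {lam : ℝ}
    {E : Matrix (Finset ι) (Finset ι) ℂ →ₗ[ℂ] ℂ} (hE : IsDegreeFourPseudoExpectation E)
    (hc : IsDegreeFourSosCertificate H lam) : (lam : ℂ) ≤ E H := by
  obtain ⟨k, c, hk⟩ := hc
  have h1 : E (H - (lam : ℂ) • (1 : Matrix (Finset ι) (Finset ι) ℂ)) = E H - lam := by
    rw [map_sub, map_smul, hE.1, smul_eq_mul, mul_one]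
  have h2 : 0 ≤ E (H - (lam : ℂ) • (1 : Matrix (Finset ι) (Finset ι) ℂ)) := by
    rw [hk, map_sum]
    exact Finset.sum_nonneg fun j _ => hE.2.2 (c j)
  rw [h1] at h2
  exact sub_nonneg.mp h2

end CAR

/-! ### Hastings's seven-mode Hamiltonian (particle–hole frame, eq. (Hph)) -/

/-- The seven fermionic modes: `0` and the pairs `(i, a)`, `i ∈ {1,2,3}`, `a ∈ {1,2}`,
encoded as `Fin 7` with `(i, a) ↦ 3(a-1) + i`. [cite: Hastings2022, §2.1 (modes)] -/
abbrev Mode : Type := Fin 7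

/-- Operators on the Fock space `ℓ²(Finset Mode)` (dimension `2⁷ = 128`). [folklore] -/
abbrev Op7 : Type := Matrix (Finset Mode) (Finset Mode) ℂ

/-- The mode `(i+1, a+1)` of Hastings's labelling, `i : Fin 3`, `a : Fin 2`. [cite: Hastings2022, §2.1] -/
def q (a : Fin 2) (i : Fin 3) : Mode := ⟨1 + 3 * (a : ℕ) + i, by omega⟩

/-- The quartet of modes `{0, (1,a), (2,a), (3,a)}` created by the interaction term.
[cite: Hastings2022, §2.1.1 (the states Ψ_a)] -/
def quartet (a : Fin 2) : Finset Mode := {0, q a 0, q a 1, q a 2}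

/-- The quartet creation operator `ψ†_0 ψ†_{1,a} ψ†_{2,a} ψ†_{3,a}`. [cite: Hastings2022, eq. (Hph)] -/
def quartetCreate (a : Fin 2) : Op7 :=
  creation 0 * (creation (q a 0) * (creation (q a 1) * creation (q a 2)))

/-- Hastings's Hamiltonian in the particle–hole frame, eq. (Hph) (the additive scalar dropped, as
in print): `H = ψ†_0ψ_0 + Σ_{a,i} ψ†_{i,a}ψ_{i,a} + ε Σ_a (ψ†_0ψ†_{1,a}ψ†_{2,a}ψ†_{3,a} + h.c.)`.
[cite: Hastings2022, §2.1.1 eq. (Hph)] -/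
def hamiltonian (ε : ℝ) : Op7 :=
  totalNumberOp + (ε : ℂ) • ∑ a : Fin 2, (quartetCreate a + (quartetCreate a)ᴴ)

/-! ### Elementary facts about the modes -/

/-- Values of the quartet modes. [folklore] -/
private theorem q_val (a : Fin 2) (i : Fin 3) : ((q a i : Mode) : ℕ) = 1 + 3 * (a : ℕ) + i := rfl

/-- `0` is not a private quartet mode. [folklore] -/
private theorem zero_ne_q (a : Fin 2) (i : Fin 3) : (0 : Mode) ≠ q a i := by
  intro h
  have := congrArg Fin.val h
  simp [q_val] at this
  omega

/-- Distinct labels give distinct private modes within a quartet. [folklore] -/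
private theorem q_ne_q (a : Fin 2) {i j : Fin 3} (h : i ≠ j) : q a i ≠ q a j := by
  intro h'
  have := congrArg Fin.val h'
  simp only [q_val] at this
  exact h (Fin.ext (by omega))

/-- Order of the modes: `0 < (1,a) < (2,a) < (3,a)`. [folklore] -/
private theorem q_lt_q (a : Fin 2) {i j : Fin 3} (h : (i : ℕ) < j) : q a i < q a j := by
  rw [Fin.lt_def, q_val, q_val]; omega

/-- Order of the modes: `0 < (i,a)`. [folklore] -/
private theorem zero_lt_q (a : Fin 2) (i : Fin 3) : (0 : Mode) < q a i := by
  rw [Fin.lt_def, q_val]; simp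

/-- Membership in a quartet, unfolded. [folklore] -/
private theorem mem_quartet {a : Fin 2} {m : Mode} :
    m ∈ quartet a ↔ m = 0 ∨ m = q a 0 ∨ m = q a 1 ∨ m = q a 2 := by
  simp [quartet]

/-- The private modes determine the quartet. [folklore] -/
private theorem quartet_injective : Function.Injective quartet := by
  intro a b h
  have hm : q a 0 ∈ quartet b := h ▸ (by simp [quartet])
  rcases mem_quartet.1 hm with h0 | h0 | h0 | h0 <;>
    · have := congrArg Fin.val h0
      simp only [q_val, Fin.val_zero] at this
      exact Fin.ext (by omega)

/-- A quartet is not empty. [folklore] -/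
private theorem quartet_ne_empty (a : Fin 2) : quartet a ≠ ∅ := by
  simp [quartet]

/-- A quartet is not everything (the other quartet's private modes are missing). [folklore] -/
private theorem quartet_ne_univ (a : Fin 2) : quartet a ≠ univ := by
  intro h
  have hm : q (a + 1) 0 ∈ quartet a := h ▸ mem_univ _
  rcases mem_quartet.1 hm with h0 | h0 | h0 | h0 <;>
    · have := congrArg Fin.val h0
      simp only [q_val, Fin.val_zero] at this
      fin_cases a <;> simp at this

/-! ### Action of the quartet creation operator on occupation basis vectors -/

/-- One Jordan–Wigner step on a scaled basis vector. [folklore] -/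
private theorem creation_mulVec_smul_single (i : Mode) (θ : ℂ) (t : Finset Mode) :
    creation i *ᵥ (θ • (Pi.single t (1 : ℂ) : Fock Mode)) =
      if i ∈ t then 0 else (θ * jwSign i t) • (Pi.single (insert i t) (1 : ℂ) : Fock Mode) := by
  rw [mulVec_smul, FermionOperatorsProofs.creation_mulVec_single]
  split_ifs
  · simp
  · rw [smul_smul]

/-- The sign `±1` picked up when the quartet `a` is created on top of `|s⟩`. [folklore] -/
def quartetSign (a : Fin 2) (s : Finset Mode) : ℂ :=
  jwSign (q a 2) s * jwSign (q a 1) (insert (q a 2) s) *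
    jwSign (q a 0) (insert (q a 1) (insert (q a 2) s)) *
      jwSign 0 (insert (q a 0) (insert (q a 1) (insert (q a 2) s)))

/-- `quartetSign` is real. [folklore] -/
private theorem star_quartetSign (a : Fin 2) (s : Finset Mode) : star (quartetSign a s) = quartetSign a s := by
  simp [quartetSign, star_jwSign, mul_comm]

/-- `quartetSign² = 1`. [folklore] -/
private theorem quartetSign_mul_self (a : Fin 2) (s : Finset Mode) :
    quartetSign a s * quartetSign a s = 1 := by
  have h := fun i t => jwSign_mul_self (ι := Mode) i t
  simp only [quartetSign]
  calc _ = (jwSign (q a 2) s * jwSign (q a 2) s) *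
      (jwSign (q a 1) (insert (q a 2) s) * jwSign (q a 1) (insert (q a 2) s)) *
      (jwSign (q a 0) (insert (q a 1) (insert (q a 2) s)) *
        jwSign (q a 0) (insert (q a 1) (insert (q a 2) s))) *
      (jwSign 0 (insert (q a 0) (insert (q a 1) (insert (q a 2) s))) *
        jwSign 0 (insert (q a 0) (insert (q a 1) (insert (q a 2) s)))) := by ring
    _ = 1 := by rw [h, h, h, h]; ring

/-- On the vacuum the sign is `+1` (the factors are created in decreasing mode order).
[folklore] -/
private theorem quartetSign_empty (a : Fin 2) : quartetSign a ∅ = 1 := by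
  have h10 : ¬ q a 2 < q a 1 := not_lt.2 (q_lt_q a (by decide)).le
  have h00 : ¬ q a 1 < q a 0 := not_lt.2 (q_lt_q a (by decide)).le
  have h20 : ¬ q a 2 < q a 0 := not_lt.2 (q_lt_q a (by decide)).le
  simp [quartetSign, jwSign, Finset.filter_insert, Finset.filter_singleton, h10, h00, h20]

/-- Creating the quartet on a configuration disjoint from it. [cite: Hastings2022, §2.1.1] -/
theorem quartetCreate_mulVec_single_of_disjoint {a : Fin 2} {s : Finset Mode}
    (h : Disjoint (quartet a) s) :
    quartetCreate a *ᵥ (Pi.single s (1 : ℂ) : Fock Mode) =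
      quartetSign a s • (Pi.single (s ∪ quartet a) (1 : ℂ) : Fock Mode) := by
  have hm : ∀ m ∈ quartet a, m ∉ s := fun m hm hs => Finset.disjoint_left.1 h hm hs
  have h2 : q a 2 ∉ s := hm _ (by simp [quartet])
  have h1 : q a 1 ∉ insert (q a 2) s := by
    simp only [mem_insert, not_or]; exact ⟨q_ne_q a (by decide), hm _ (by simp [quartet])⟩
  have h0 : q a 0 ∉ insert (q a 1) (insert (q a 2) s) := by
    simp only [mem_insert, not_or]
    exact ⟨q_ne_q a (by decide), q_ne_q a (by decide), hm _ (by simp [quartet])⟩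
  have hz : (0 : Mode) ∉ insert (q a 0) (insert (q a 1) (insert (q a 2) s)) := by
    simp only [mem_insert, not_or]
    exact ⟨zero_ne_q a 0, zero_ne_q a 1, zero_ne_q a 2, hm _ (by simp [quartet])⟩
  have hset : insert 0 (insert (q a 0) (insert (q a 1) (insert (q a 2) s))) = s ∪ quartet a := by
    ext m; simp [quartet]
  rw [quartetCreate, ← mulVec_mulVec, ← mulVec_mulVec, ← mulVec_mulVec,
    ← one_smul ℂ (Pi.single s (1 : ℂ) : Fock Mode), creation_mulVec_smul_single, if_neg h2,
    creation_mulVec_smul_single, if_neg h1, creation_mulVec_smul_single, if_neg h0,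
    creation_mulVec_smul_single, if_neg hz, hset, one_mul, quartetSign]

/-- Creating the quartet on a configuration meeting it gives zero (Pauli principle).
[cite: Hastings2022, §2.1.1] -/
theorem quartetCreate_mulVec_single_of_not_disjoint {a : Fin 2} {s : Finset Mode}
    (h : ¬ Disjoint (quartet a) s) :
    quartetCreate a *ᵥ (Pi.single s (1 : ℂ) : Fock Mode) = 0 := by
  rw [quartetCreate, ← mulVec_mulVec, ← mulVec_mulVec, ← mulVec_mulVec,
    ← one_smul ℂ (Pi.single s (1 : ℂ) : Fock Mode), creation_mulVec_smul_single]
  by_cases h2 : q a 2 ∈ s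
  · rw [if_pos h2, mulVec_zero, mulVec_zero, mulVec_zero]
  rw [if_neg h2, creation_mulVec_smul_single]
  by_cases h1 : q a 1 ∈ insert (q a 2) s
  · rw [if_pos h1, mulVec_zero, mulVec_zero]
  rw [if_neg h1, creation_mulVec_smul_single]
  by_cases h0 : q a 0 ∈ insert (q a 1) (insert (q a 2) s)
  · rw [if_pos h0, mulVec_zero]
  rw [if_neg h0, creation_mulVec_smul_single]
  by_cases hz : (0 : Mode) ∈ insert (q a 0) (insert (q a 1) (insert (q a 2) s))
  · rw [if_pos hz]
  exfalso
  apply h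
  rw [Finset.disjoint_left]
  intro m hm
  simp only [mem_insert, not_or] at h1 h0 hz
  rcases mem_quartet.1 hm with rfl | rfl | rfl | rfl
  · exact hz.2.2.2
  · exact h0.2.2
  · exact h1.2
  · exact h2

/-- The matrix entries of the quartet creation operator. [cite: Hastings2022, §2.1.1] -/
theorem quartetCreate_apply (a : Fin 2) (t s : Finset Mode) :
    quartetCreate a t s =
      if Disjoint (quartet a) s ∧ t = s ∪ quartet a then quartetSign a s else 0 := by
  have key : quartetCreate a t s = (quartetCreate a *ᵥ (Pi.single s (1 : ℂ) : Fock Mode)) t := by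
    rw [mulVec_single_one]; rfl
  rw [key]
  by_cases hd : Disjoint (quartet a) s
  · rw [quartetCreate_mulVec_single_of_disjoint hd, Pi.smul_apply, smul_eq_mul]
    by_cases ht : t = s ∪ quartet a
    · subst ht; simp [hd]
    · rw [if_neg (fun h => ht h.2), Pi.single_eq_of_ne ht, mul_zero]
  · rw [quartetCreate_mulVec_single_of_not_disjoint hd, if_neg (fun h => hd h.1), Pi.zero_apply]

/-! ### Entries of the Hamiltonian needed for `Ẽ[H]` -/

/-- Two quartets always meet (in the mode `0`). [folklore] -/
private theorem not_disjoint_quartet (a b : Fin 2) : ¬ Disjoint (quartet b) (quartet a) :=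
  Finset.not_disjoint_iff.2 ⟨0, by simp [quartet], by simp [quartet]⟩

/-- `⟨∅| A†_b |∅⟩ = 0`. [folklore] -/
private theorem quartetCreate_apply_empty_empty (b : Fin 2) : quartetCreate b ∅ ∅ = 0 := by
  rw [quartetCreate_apply, if_neg]
  rintro ⟨-, h⟩
  exact quartet_ne_empty b (by rw [empty_union] at h; exact h.symm)

/-- `⟨F| A†_b |F⟩ = 0`. [folklore] -/
private theorem quartetCreate_apply_univ_univ (b : Fin 2) : quartetCreate b univ univ = 0 := by
  rw [quartetCreate_apply, if_neg]
  rintro ⟨h, -⟩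
  exact Finset.disjoint_left.1 h (show (0 : Mode) ∈ quartet b by simp [quartet]) (mem_univ _)

/-- `⟨∅| A†_b |Q_a⟩ = 0`. [folklore] -/
private theorem quartetCreate_apply_empty_quartet (a b : Fin 2) : quartetCreate b ∅ (quartet a) = 0 := by
  rw [quartetCreate_apply, if_neg]
  rintro ⟨h, -⟩
  exact not_disjoint_quartet a b h

/-- `⟨Q_a| A†_b |∅⟩ = δ_{ab}`. [cite: Hastings2022, §2.1.1 (the states Ψ_a)] -/
theorem quartetCreate_apply_quartet_empty (a b : Fin 2) :
    quartetCreate b (quartet a) ∅ = if a = b then 1 else 0 := by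
  rw [quartetCreate_apply, empty_union, quartetSign_empty]
  by_cases h : a = b
  · subst h; simp
  · rw [if_neg h, if_neg]
    rintro ⟨-, h'⟩
    exact h (quartet_injective h')

/-- Entries of the number operator. [folklore] -/
private theorem totalNumberOp_apply (t s : Finset Mode) :
    (totalNumberOp : Op7) t s = if t = s then (s.card : ℂ) else 0 := by
  rw [totalNumberOp_eq_diagonal, diagonal_apply]
  split_ifs with h
  · rw [h]
  · rfl

/-- Entries of the Hamiltonian. [cite: Hastings2022, eq. (Hph)] -/
theorem hamiltonian_apply (ε : ℝ) (t s : Finset Mode) :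
    hamiltonian ε t s = (if t = s then (s.card : ℂ) else 0) +
      (ε : ℂ) * ∑ b : Fin 2, (quartetCreate b t s + star (quartetCreate b s t)) := by
  simp only [hamiltonian, Matrix.add_apply, Matrix.smul_apply, Matrix.sum_apply,
    conjTranspose_apply, totalNumberOp_apply, smul_eq_mul]

/-- The Hamiltonian is Hermitian. [cite: Hastings2022, eq. (Hph)] -/
theorem hamiltonian_isHermitian (ε : ℝ) : (hamiltonian ε).IsHermitian := by
  unfold Matrix.IsHermitian hamiltonian
  rw [conjTranspose_add, totalNumberOp_eq_diagonal, diagonal_conjTranspose, conjTranspose_smul,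
    conjTranspose_sum]
  congr 1
  · congr 1; funext s; simp
  · rw [Complex.star_def, Complex.conj_ofReal]
    congr 1
    refine Finset.sum_congr rfl fun b _ => ?_
    rw [conjTranspose_add, conjTranspose_conjTranspose, add_comm]

/-! ### The pseudo-state and the pseudo-expectation `Ẽ_{u,v}` -/

/-- The (non-positive) "pseudo-density matrix" representing Hastings's degree-4 pseudo-expectation
on words of degree `≤ 4`: `ρ̃ = (1-u)|∅⟩⟨∅| + u|F⟩⟨F| + v Σ_a (|Q_a⟩⟨∅| + |∅⟩⟨Q_a|)` (`F` = all
modes occupied, `Q_a` = the quartet states `Ψ_a`). For `v = 0` it is the genuine mixture "with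
probability `u` all modes occupied, with probability `1-u` all empty"; the `v`-term produces
`Ẽ[ψ†_0ψ†_{1,a}ψ†_{2,a}ψ†_{3,a}] = v`. (It agrees with the printed assignment on every normal-ordered
word of degree `≤ 4`; words of degree `≥ 6` do not enter degree-4 positivity.)
[cite: Hastings2022, §2.1.1 (definition of Ẽ)] -/
def pseudoState (u v : ℝ) : Op7 :=
  ((1 - u : ℝ) : ℂ) • Matrix.single ∅ ∅ 1 + (u : ℂ) • Matrix.single univ univ 1 +
    (v : ℂ) • ∑ a : Fin 2, (Matrix.single (quartet a) ∅ 1 + Matrix.single ∅ (quartet a) 1)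

/-- Hastings's degree-4 pseudo-expectation `Ẽ_{u,v}[X] = Tr(ρ̃ X)` as a linear functional.
[cite: Hastings2022, §2.1.1] -/
def pseudoE (u v : ℝ) : Op7 →ₗ[ℂ] ℂ where
  toFun X := (pseudoState u v * X).trace
  map_add' X Y := by rw [mul_add, trace_add]
  map_smul' c X := by rw [mul_smul_comm, trace_smul, RingHom.id_apply]

/-- Unfolding. [folklore] -/
private theorem pseudoE_apply (u v : ℝ) (X : Op7) : pseudoE u v X = (pseudoState u v * X).trace := rfl

/-- `Tr(E_{st} X) = X_{ts}`. [folklore] -/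
private theorem trace_single_mul' (s t : Finset Mode) (X : Op7) :
    (Matrix.single s t (1 : ℂ) * X).trace = X t s := by
  rw [Matrix.trace_single_mul, one_smul]

/-- `Ẽ_{u,v}` in terms of four matrix entries. [cite: Hastings2022, §2.1.1] -/
theorem pseudoE_eq (u v : ℝ) (X : Op7) :
    pseudoE u v X = ((1 - u : ℝ) : ℂ) * X ∅ ∅ + (u : ℂ) * X univ univ +
      (v : ℂ) * ∑ a : Fin 2, (X ∅ (quartet a) + X (quartet a) ∅) := by
  simp only [pseudoE_apply, pseudoState, add_mul, smul_mul_assoc, Finset.sum_mul, trace_add,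
    trace_smul, trace_sum, trace_single_mul', smul_eq_mul]

/-- Normalisation `Ẽ[1] = 1`. [cite: Hastings2022, §2.1.1] -/
theorem pseudoE_one (u v : ℝ) : pseudoE u v 1 = 1 := by
  rw [pseudoE_eq]
  have h : ∀ a : Fin 2, (1 : Op7) ∅ (quartet a) + (1 : Op7) (quartet a) ∅ = 0 := fun a => by
    rw [one_apply_ne (quartet_ne_empty a).symm, one_apply_ne (quartet_ne_empty a), add_zero]
  simp only [one_apply_eq, h, Finset.sum_const_zero, mul_zero, add_zero, mul_one]
  push_cast
  ring

/-- Hermiticity `Ẽ[X†] = conj Ẽ[X]`. [cite: Hastings2022, §2.1.1] -/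
theorem pseudoE_conjTranspose (u v : ℝ) (X : Op7) : pseudoE u v Xᴴ = star (pseudoE u v X) := by
  rw [pseudoE_eq, pseudoE_eq]
  simp only [conjTranspose_apply, star_add, star_mul', star_sum, Complex.star_def,
    Complex.conj_ofReal]
  congr 1
  congr 1
  exact Finset.sum_congr rfl fun a _ => add_comm _ _

/-- **The pseudo-energy**: `Ẽ_{u,v}[H_ε] = 7u + 4εv` ("the factor of 4 in front of εv is a
combination of 2 (for the two choices of a) times 2"). [cite: Hastings2022, §2.1.1, eq. for Ẽ[H]] -/
theorem pseudoE_hamiltonian (u v ε : ℝ) :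
    pseudoE u v (hamiltonian ε) = ((7 * u + 4 * ε * v : ℝ) : ℂ) := by
  rw [pseudoE_eq]
  simp only [hamiltonian_apply, quartetCreate_apply_empty_empty, quartetCreate_apply_univ_univ,
    quartetCreate_apply_empty_quartet, quartetCreate_apply_quartet_empty, (quartet_ne_empty _).symm,
    quartet_ne_empty, if_true, if_false, card_empty, Finset.card_univ, Fintype.card_fin,
    star_zero, add_zero, zero_add, Fin.sum_univ_two, Fin.isValue]
  simp
  ring

/-! ### The parameters: `v = -2ε/7`, `u = v² + 2v⁴` -/

/-- Hastings's optimising choice `v = -2ε/7 + O(ε³)`; we take `v = -2ε/7` exactly.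
[cite: Hastings2022, §2.1.1 ("taking v = -2ε/7")] -/
def vOf (ε : ℝ) : ℝ := -(2 * ε / 7)

/-- `u = v² + O(v⁴)`; we take `u = v² + 2v⁴`, which makes the `2 × 2` matrix `[[1-u, v],[v, u]]`
positive semidefinite for `|v| ≤ 1/3`. [cite: Hastings2022, §2.1.1 ("taking u = v² + O(v⁴)")] -/
def uOf (ε : ℝ) : ℝ := vOf ε ^ 2 + 2 * vOf ε ^ 4

/-- The pseudo-energy at the chosen parameters: `Ẽ[H_ε] = -(4/7)ε² + (32/343)ε⁴`
(print: `-(4/7)ε² + O(ε⁴)`). [cite: Hastings2022, §2.1.1, eq. (Ẽ[H] = -4ε²/7 + O(ε⁴))] -/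
theorem pseudoE_hamiltonian_val (ε : ℝ) :
    pseudoE (uOf ε) (vOf ε) (hamiltonian ε) = ((-(4 / 7) * ε ^ 2 + 32 / 343 * ε ^ 4 : ℝ) : ℂ) := by
  rw [pseudoE_hamiltonian]
  congr 1
  simp only [uOf, vOf]
  ring

/-- The parameter window: for `0 ≤ ε ≤ 1`, `0 ≤ u ≤ 1` and `v² ≤ u(1-u)`. [folklore] -/
private theorem uOf_vOf_window {ε : ℝ} (h0 : 0 ≤ ε) (h1 : ε ≤ 1) :
    0 ≤ uOf ε ∧ uOf ε ≤ 1 ∧ vOf ε ^ 2 ≤ uOf ε * (1 - uOf ε) := by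
  have hv : vOf ε ^ 2 ≤ 4 / 49 := by
    rw [vOf]; nlinarith
  have hv0 : 0 ≤ vOf ε ^ 2 := sq_nonneg _
  refine ⟨by rw [uOf]; positivity, by rw [uOf]; nlinarith, ?_⟩
  rw [uOf]
  nlinarith [mul_nonneg hv0 hv0, mul_nonneg (mul_nonneg hv0 hv0) hv0]

/-! ### The lower bound `H_ε ⪰ -ε²/2·1` (a sum-of-squares decomposition with a diagonal remainder)

This replaces the exact diagonalisation of print ("the ground state energy is equal to
`E₀ = -ε²/2 + O(ε⁴)`") by an explicit operator inequality valid for `0 ≤ ε ≤ 1`, which is all the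
barrier needs: for each quartet `a`, with `M = A†_a`, `P` = projection onto configurations
containing `Q_a`, `R` = projection onto configurations missing the other quartet's private modes,
`T₁ = (ε/2) M R + 2 P R` and `T₂ = ε M (1-R) + P (1-R)` give
`ε(M + M†) = T₁†T₁ + T₂†T₂ - [(ε²/4) Π^∅_a R + 4 P R + ε² Π^∅_a (1-R) + P (1-R)]`
(`Π^∅_a = M†M` = projection onto configurations disjoint from `Q_a`), and the diagonal operator
`N̂ + ε²/2 - Σ_a [...]` has nonnegative entries. -/

/-- The private modes of the OTHER quartet: the complement of `Q_a`. [folklore] -/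
def rest (a : Fin 2) : Finset Mode := univ \ quartet a

/-- Projection onto configurations disjoint from the quartet `Q_a`. [folklore] -/
def projEmpty (a : Fin 2) : Op7 := diagonal fun t => if Disjoint (quartet a) t then 1 else 0

/-- Projection onto configurations containing the quartet `Q_a`. [folklore] -/
def projFull (a : Fin 2) : Op7 := diagonal fun t => if quartet a ⊆ t then 1 else 0

/-- Projection onto configurations missing all of `rest a`. [folklore] -/
def projRest (a : Fin 2) : Op7 := diagonal fun t => if Disjoint (rest a) t then 1 else 0

/-- The complementary projection `1 - projRest a`. [folklore] -/
def projRestC (a : Fin 2) : Op7 := diagonal fun t => if Disjoint (rest a) t then 0 else 1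

/-- A basis vector with a general coefficient is a multiple of the unit one. [folklore] -/
private theorem single_eq_smul_single (s : Finset Mode) (c : ℂ) :
    (Pi.single s c : Fock Mode) = c • (Pi.single s (1 : ℂ) : Fock Mode) := by
  ext t
  by_cases h : t = s
  · subst h; simp
  · simp [Pi.single_eq_of_ne h]

/-- Gram entries: `(M†M)_{ts} = ⟨M e_t, M e_s⟩`. [folklore] -/
private theorem conjTranspose_mul_apply_eq_dotProduct (M : Op7) (t s : Finset Mode) :
    (Mᴴ * M) t s =
      star (M *ᵥ (Pi.single t (1 : ℂ) : Fock Mode)) ⬝ᵥ (M *ᵥ (Pi.single s (1 : ℂ) : Fock Mode)) := by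
  simp [mul_apply, dotProduct, conjTranspose_apply, col_apply]

/-- `⟨e_T, e_S⟩ = [T = S]`. [folklore] -/
private theorem star_single_dotProduct_single (T S : Finset Mode) :
    star (Pi.single T (1 : ℂ) : Fock Mode) ⬝ᵥ (Pi.single S (1 : ℂ) : Fock Mode) =
      if T = S then 1 else 0 := by
  rw [← Pi.single_star, star_one, single_one_dotProduct, Pi.single_apply]

/-- Disjoint translates by the quartet are equal iff the configurations are. [folklore] -/
private theorem union_quartet_eq_iff {a : Fin 2} {t s : Finset Mode} (ht : Disjoint (quartet a) t)
    (hs : Disjoint (quartet a) s) : t ∪ quartet a = s ∪ quartet a ↔ t = s := by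
  refine ⟨fun h => ?_, fun h => by rw [h]⟩
  have h1 := Finset.union_sdiff_cancel_right ht.symm
  have h2 := Finset.union_sdiff_cancel_right hs.symm
  rw [← h1, h, h2]

/-- `A_a A†_a`-type identity: `(A†_a)† A†_a` — here `M†M` for `M = A†_a` — is the projection onto
configurations disjoint from `Q_a`. [folklore] -/
private theorem quartetCreate_gram (a : Fin 2) :
    (quartetCreate a)ᴴ * quartetCreate a = projEmpty a := by
  ext t s
  rw [conjTranspose_mul_apply_eq_dotProduct, projEmpty, diagonal_apply]
  by_cases hs : Disjoint (quartet a) s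
  · rw [quartetCreate_mulVec_single_of_disjoint hs]
    by_cases ht : Disjoint (quartet a) t
    · rw [quartetCreate_mulVec_single_of_disjoint ht, star_smul, smul_dotProduct, dotProduct_smul,
        star_single_dotProduct_single, star_quartetSign, smul_eq_mul, smul_eq_mul]
      by_cases hts : t = s
      · subst hts; simp [quartetSign_mul_self, ht]
      · rw [if_neg (fun h => hts ((union_quartet_eq_iff ht hs).1 h)), if_neg hts, mul_zero, mul_zero]
    · rw [quartetCreate_mulVec_single_of_not_disjoint ht, star_zero, zero_dotProduct]
      have hts : t ≠ s := fun h => ht (h ▸ hs)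
      rw [if_neg hts]
  · rw [quartetCreate_mulVec_single_of_not_disjoint hs, dotProduct_zero]
    by_cases hts : t = s
    · subst hts; rw [if_pos rfl, if_neg hs]
    · rw [if_neg hts]

/-- `P M = M`: the range of `A†_a` consists of configurations containing `Q_a`. [folklore] -/
private theorem projFull_mul_quartetCreate (a : Fin 2) : projFull a * quartetCreate a = quartetCreate a := by
  refine Literature.MathematicalPhysics.QuantumLattice.ext_of_mulVec_single fun s => ?_
  rw [← mulVec_mulVec]
  by_cases hs : Disjoint (quartet a) s
  · rw [quartetCreate_mulVec_single_of_disjoint hs, mulVec_smul, projFull, diagonal_mulVec_single,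
      if_pos subset_union_right, mul_one]
  · rw [quartetCreate_mulVec_single_of_not_disjoint hs, mulVec_zero]

/-- `rest a` is disjoint from `Q_a`. [folklore] -/
private theorem disjoint_rest_quartet (a : Fin 2) : Disjoint (rest a) (quartet a) := by
  rw [rest]; exact sdiff_disjoint

/-- `R M = M R`: creating the quartet does not touch the modes of `rest a`. [folklore] -/
private theorem projRest_mul_quartetCreate (a : Fin 2) :
    projRest a * quartetCreate a = quartetCreate a * projRest a := by
  refine Literature.MathematicalPhysics.QuantumLattice.ext_of_mulVec_single fun s => ?_
  rw [← mulVec_mulVec, ← mulVec_mulVec]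
  have hR : ∀ t : Finset Mode, projRest a *ᵥ (Pi.single t (1 : ℂ) : Fock Mode) =
      (if Disjoint (rest a) t then (1 : ℂ) else 0) • (Pi.single t (1 : ℂ) : Fock Mode) := fun t => by
    rw [projRest, diagonal_mulVec_single, mul_one, single_eq_smul_single]
  rw [hR, mulVec_smul]
  by_cases hs : Disjoint (quartet a) s
  · rw [quartetCreate_mulVec_single_of_disjoint hs, mulVec_smul, hR, smul_comm]
    congr 1
    simp only [disjoint_union_right, disjoint_rest_quartet a, and_true]
  · rw [quartetCreate_mulVec_single_of_not_disjoint hs, mulVec_zero, smul_zero]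

/-- `(1 - R) M = M (1 - R)`. [folklore] -/
private theorem projRestC_eq (a : Fin 2) : projRestC a = 1 - projRest a := by
  rw [projRestC, projRest, ← diagonal_one, diagonal_sub]
  congr 1; funext t; split_ifs <;> simp

/-- `(1 - R) M = M (1 - R)`. [folklore] -/
private theorem projRestC_mul_quartetCreate (a : Fin 2) :
    projRestC a * quartetCreate a = quartetCreate a * projRestC a := by
  rw [projRestC_eq, sub_mul, mul_sub, one_mul, mul_one, projRest_mul_quartetCreate]

/-- A `0/1` diagonal matrix is a Hermitian idempotent commuting with every diagonal matrix.
[folklore] -/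
private theorem diagonal_indicator_facts (p r : Finset Mode → Prop) [DecidablePred p] [DecidablePred r] :
    (diagonal fun t => if p t then (1 : ℂ) else 0)ᴴ = (diagonal fun t => if p t then (1 : ℂ) else 0) ∧
    (diagonal fun t => if p t then (1 : ℂ) else 0) * (diagonal fun t => if p t then (1 : ℂ) else 0) =
      (diagonal fun t => if p t then (1 : ℂ) else 0) ∧
    (diagonal fun t => if p t then (1 : ℂ) else 0) * (diagonal fun t => if r t then (1 : ℂ) else 0) =
      (diagonal fun t => if r t then (1 : ℂ) else 0) * (diagonal fun t => if p t then (1 : ℂ) else 0) := by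
  refine ⟨?_, ?_, ?_⟩
  · rw [diagonal_conjTranspose]; congr 1; funext t; by_cases h : p t <;> simp [h]
  · rw [diagonal_mul_diagonal]; congr 1; funext t; by_cases h : p t <;> simp [h]
  · rw [diagonal_mul_diagonal, diagonal_mul_diagonal]; congr 1; funext t; ring

/-- **The `T†T` trick.** For a "partial isometry-like" `M` with range projection `P` (`PM = M`) and
a projection `R` commuting with `M` and `P`:
`(αMR + βPR)†(αMR + βPR) = α² M†M R + αβ (M + M†) R + β² P R`. [folklore] -/
private theorem tTrick {M P R : Op7} (hP : Pᴴ = P) (hPP : P * P = P) (hPM : P * M = M) (hR : Rᴴ = R)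
    (hRR : R * R = R) (hRM : R * M = M * R) (hRP : R * P = P * R) (α β : ℝ) :
    ((α : ℂ) • (M * R) + (β : ℂ) • (P * R))ᴴ * ((α : ℂ) • (M * R) + (β : ℂ) • (P * R)) =
      ((α ^ 2 : ℝ) : ℂ) • (Mᴴ * M * R) + ((α * β : ℝ) : ℂ) • ((M + Mᴴ) * R) +
        ((β ^ 2 : ℝ) : ℂ) • (P * R) := by
  have hRMh : R * Mᴴ = Mᴴ * R := by
    have := congrArg conjTranspose hRM
    rw [conjTranspose_mul, conjTranspose_mul, hR] at this
    exact this.symm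
  have hMP : Mᴴ * P = Mᴴ := by
    rw [← hP, ← conjTranspose_mul, hPM]
  have h1 : R * Mᴴ * (M * R) = Mᴴ * M * R := by
    rw [hRMh, mul_assoc, ← mul_assoc R, hRM, mul_assoc, hRR, ← mul_assoc]
  have h2 : R * Mᴴ * (P * R) = Mᴴ * R := by
    rw [hRMh, mul_assoc, ← mul_assoc R, hRP, mul_assoc, hRR, ← mul_assoc, hMP]
  have h3 : R * P * (M * R) = M * R := by
    rw [hRP, mul_assoc, ← mul_assoc R, hRM, mul_assoc, hRR, ← mul_assoc, hPM]
  have h4 : R * P * (P * R) = P * R := by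
    rw [hRP, mul_assoc, ← mul_assoc R, hRP, mul_assoc, hRR, ← mul_assoc, hPP]
  rw [conjTranspose_add, conjTranspose_smul, conjTranspose_smul, conjTranspose_mul,
    conjTranspose_mul, hR, hP]
  simp only [Complex.star_def, Complex.conj_ofReal, add_mul, mul_add, smul_mul_assoc,
    mul_smul_comm, h1, h2, h3, h4]
  push_cast
  module

/-- The diagonal penalty operator charged to quartet `a`. [folklore] -/
def penalty (ε : ℝ) (a : Fin 2) : Op7 :=
  ((ε ^ 2 / 4 : ℝ) : ℂ) • (projEmpty a * projRest a) + ((4 : ℝ) : ℂ) • (projFull a * projRest a) +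
    ((ε ^ 2 : ℝ) : ℂ) • (projEmpty a * projRestC a) + ((1 : ℝ) : ℂ) • (projFull a * projRestC a)

/-- **Per-quartet bound**: `ε(A†_a + A_a) + penalty ⪰ 0`. [folklore] -/
private theorem interaction_add_penalty_posSemidef (ε : ℝ) (a : Fin 2) :
    ((ε : ℂ) • (quartetCreate a + (quartetCreate a)ᴴ) + penalty ε a).PosSemidef := by
  obtain ⟨hPh', hPP', hPRaux⟩ := diagonal_indicator_facts (fun t => quartet a ⊆ t)
    (fun t => Disjoint (rest a) t)
  obtain ⟨hRh', hRR', -⟩ := diagonal_indicator_facts (fun t => Disjoint (rest a) t)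
    (fun t => Disjoint (rest a) t)
  have hPh : (projFull a)ᴴ = projFull a := hPh'
  have hPP : projFull a * projFull a = projFull a := hPP'
  have hRh : (projRest a)ᴴ = projRest a := hRh'
  have hRR : projRest a * projRest a = projRest a := hRR'
  have hRP : projRest a * projFull a = projFull a * projRest a := hPRaux.symm
  have hRCh : (projRestC a)ᴴ = projRestC a := by
    rw [projRestC_eq, conjTranspose_sub, conjTranspose_one, hRh]
  have hRCRC : projRestC a * projRestC a = projRestC a := by
    rw [projRestC_eq, sub_mul, one_mul, mul_sub, mul_one, hRR, sub_self, sub_zero]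
  have hRCP : projRestC a * projFull a = projFull a * projRestC a := by
    rw [projRestC_eq, sub_mul, one_mul, mul_sub, mul_one, hRP]
  have e1 := tTrick (M := quartetCreate a) hPh hPP (projFull_mul_quartetCreate a) hRh hRR
    (projRest_mul_quartetCreate a) hRP (ε / 2) 2
  have e2 := tTrick (M := quartetCreate a) hPh hPP (projFull_mul_quartetCreate a) hRCh hRCRC
    (projRestC_mul_quartetCreate a) hRCP ε 1
  have key : (ε : ℂ) • (quartetCreate a + (quartetCreate a)ᴴ) + penalty ε a =
      (((ε / 2 : ℝ) : ℂ) • (quartetCreate a * projRest a) + ((2 : ℝ) : ℂ) • (projFull a * projRest a))ᴴ *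
        (((ε / 2 : ℝ) : ℂ) • (quartetCreate a * projRest a) + ((2 : ℝ) : ℂ) • (projFull a * projRest a)) +
      (((ε : ℝ) : ℂ) • (quartetCreate a * projRestC a) + ((1 : ℝ) : ℂ) • (projFull a * projRestC a))ᴴ *
        (((ε : ℝ) : ℂ) • (quartetCreate a * projRestC a) + ((1 : ℝ) : ℂ) • (projFull a * projRestC a)) := by
    rw [e1, e2, quartetCreate_gram, penalty]
    have hsplit : (quartetCreate a + (quartetCreate a)ᴴ) =
        (quartetCreate a + (quartetCreate a)ᴴ) * projRest a +
          (quartetCreate a + (quartetCreate a)ᴴ) * projRestC a := by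
      rw [projRestC_eq, mul_sub, mul_one, add_sub_cancel]
    conv_lhs => rw [hsplit]
    push_cast
    module
  rw [key]
  exact (posSemidef_conjTranspose_mul_self _).add (posSemidef_conjTranspose_mul_self _)

/-! #### The diagonal remainder -/

/-- `ε`-free part of `4×` the diagonal remainder. [folklore] -/
def indI (s : Finset Mode) : ℤ :=
  4 * (s.card : ℤ) - ∑ a : Fin 2,
    ((if quartet a ⊆ s ∧ Disjoint (rest a) s then 16 else 0) +
      (if quartet a ⊆ s ∧ ¬ Disjoint (rest a) s then 4 else 0))

/-- Coefficient of `ε²` in `4×` the diagonal remainder. [folklore] -/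
def indJ (s : Finset Mode) : ℤ :=
  2 - ∑ a : Fin 2,
    ((if Disjoint (quartet a) s ∧ Disjoint (rest a) s then 1 else 0) +
      (if Disjoint (quartet a) s ∧ ¬ Disjoint (rest a) s then 4 else 0))

set_option maxRecDepth 4000 in
/-- The finite check over the `2⁷` configurations: `I(s) + min(J(s), 0) ≥ 0`
(vacuum: `I = J = 0`; `s = Q_a`: `I = 0, J = 2`; `∅ ≠ s ⊆ rest a`: `I = 4|s| ≥ 4, J = -2`;
otherwise `I ≥ 4`, `J = 2`). [folklore] -/
private theorem indI_add_min_indJ_nonneg : ∀ s : Finset Mode, 0 ≤ indI s + min (indJ s) 0 := by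
  decide

/-- The diagonal remainder `d(s) = (I(s) + ε² J(s))/4`. [folklore] -/
def remainder (ε : ℝ) (s : Finset Mode) : ℝ := ((indI s : ℝ) + ε ^ 2 * (indJ s : ℝ)) / 4

/-- The remainder is nonnegative for `0 ≤ ε ≤ 1`. [folklore] -/
private theorem remainder_nonneg {ε : ℝ} (h0 : 0 ≤ ε) (h1 : ε ≤ 1) (s : Finset Mode) :
    0 ≤ remainder ε s := by
  have h := indI_add_min_indJ_nonneg s
  have hε2 : ε ^ 2 ≤ 1 := by nlinarith
  have hε0 : 0 ≤ ε ^ 2 := sq_nonneg ε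
  rw [remainder]
  apply div_nonneg _ (by norm_num)
  rcases le_or_gt 0 (indJ s) with hJ | hJ
  · rw [min_eq_right hJ, add_zero] at h
    have hI : (0 : ℝ) ≤ indI s := by exact_mod_cast h
    have hJ' : (0 : ℝ) ≤ indJ s := by exact_mod_cast hJ
    positivity
  · rw [min_eq_left hJ.le] at h
    have hI : (0 : ℝ) ≤ (indI s : ℝ) + indJ s := by exact_mod_cast h
    have hJ' : (indJ s : ℝ) ≤ 0 := by exact_mod_cast hJ.le
    nlinarith

/-- Entries of the penalty operator (a diagonal matrix). [folklore] -/
private theorem penalty_eq_diagonal (ε : ℝ) (a : Fin 2) :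
    penalty ε a = diagonal fun t =>
      ((ε ^ 2 / 4 : ℝ) : ℂ) * ((if Disjoint (quartet a) t then 1 else 0) *
          (if Disjoint (rest a) t then 1 else 0)) +
        ((4 : ℝ) : ℂ) * ((if quartet a ⊆ t then 1 else 0) * (if Disjoint (rest a) t then 1 else 0)) +
        ((ε ^ 2 : ℝ) : ℂ) * ((if Disjoint (quartet a) t then 1 else 0) *
          (if Disjoint (rest a) t then 0 else 1)) +
        ((1 : ℝ) : ℂ) * ((if quartet a ⊆ t then 1 else 0) * (if Disjoint (rest a) t then 0 else 1)) := by
  simp only [penalty, projEmpty, projFull, projRest, projRestC, diagonal_mul_diagonal, ← diagonal_smul,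
    diagonal_add]
  congr 1

/-- The bookkeeping identity: `N̂ + (ε²/2)·1 - Σ_a penalty_a = diag(d)`. [folklore] -/
private theorem totalNumberOp_add_sub_penalty (ε : ℝ) :
    (totalNumberOp : Op7) + ((ε ^ 2 / 2 : ℝ) : ℂ) • (1 : Op7) - ∑ a, penalty ε a =
      diagonal fun s => ((remainder ε s : ℝ) : ℂ) := by
  rw [totalNumberOp_eq_diagonal, Fin.sum_univ_two, penalty_eq_diagonal, penalty_eq_diagonal,
    ← diagonal_one, ← diagonal_smul, diagonal_add, diagonal_add, diagonal_sub]
  congr 1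
  funext s
  simp only [remainder, indI, indJ, Fin.sum_univ_two, Fin.isValue, Pi.smul_apply, smul_eq_mul,
    mul_one]
  push_cast
  by_cases h1 : quartet 0 ⊆ s <;> by_cases h2 : Disjoint (rest 0) s <;>
    by_cases h3 : Disjoint (quartet 0) s <;> by_cases h4 : quartet 1 ⊆ s <;>
      by_cases h5 : Disjoint (rest 1) s <;> by_cases h6 : Disjoint (quartet 1) s <;>
        simp [h1, h2, h3, h4, h5, h6] <;> ring

/-- **Lower bound.** `H_ε + (ε²/2)·1 ⪰ 0` for `0 ≤ ε ≤ 1`. [folklore] (print: "the ground state energy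
is equal to `E₀ = -ε²/2 + O(ε⁴)`" [cite: Hastings2022, §2.1.1]) -/
theorem hamiltonian_add_posSemidef {ε : ℝ} (h0 : 0 ≤ ε) (h1 : ε ≤ 1) :
    (hamiltonian ε + ((ε ^ 2 / 2 : ℝ) : ℂ) • (1 : Op7)).PosSemidef := by
  have key : hamiltonian ε + ((ε ^ 2 / 2 : ℝ) : ℂ) • (1 : Op7) =
      ∑ a, ((ε : ℂ) • (quartetCreate a + (quartetCreate a)ᴴ) + penalty ε a) +
        diagonal fun s => ((remainder ε s : ℝ) : ℂ) := by
    rw [← totalNumberOp_add_sub_penalty, Finset.sum_add_distrib, ← Finset.smul_sum, hamiltonian]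
    abel
  rw [key]
  refine PosSemidef.add ?_ (PosSemidef.diagonal fun s => ?_)
  · exact posSemidef_sum _ fun a _ => interaction_add_penalty_posSemidef ε a
  · exact Complex.zero_le_real.2 (remainder_nonneg h0 h1 s)

/-! ### Degree-4 positivity of `Ẽ_{u,v}`: grading by particle number

Hastings: "Since the pseudo-expectation of any monomial of non-vanishing charge vanishes, we may
assume that `O` is a sum of monomials of some given charge `q`"; the `v`-dependent part only
involves charge `±2/3` (here: the `ψψ` part of `O` acting on `Ψ_a` against the `ψ†ψ†` part acting
on the vacuum), and "it reduces to showing positive semi-definiteness of the two-by-two matrix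
`[[1-u, v],[v, u]]`". We implement this with the particle-number grading of the Fock space and two
Cauchy–Schwarz inequalities. -/

/-- `ψ` is supported on configurations with exactly `k` particles (`k : ℤ`; for `k < 0` this says
`ψ = 0`). [folklore] -/
private def SuppCard (k : ℤ) (ψ : Fock Mode) : Prop := ∀ t, ψ t ≠ 0 → (t.card : ℤ) = k

/-- [folklore] -/
private theorem SuppCard.zero (k : ℤ) : SuppCard k (0 : Fock Mode) := fun _ h => absurd rfl h

/-- [folklore] -/
private theorem SuppCard.add {k : ℤ} {ψ φ : Fock Mode} (hψ : SuppCard k ψ) (hφ : SuppCard k φ) :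
    SuppCard k (ψ + φ) := by
  intro t ht
  by_cases h : ψ t = 0
  · rw [Pi.add_apply, h, zero_add] at ht; exact hφ t ht
  · exact hψ t h

/-- [folklore] -/
private theorem SuppCard.smul {k : ℤ} {ψ : Fock Mode} (c : ℂ) (hψ : SuppCard k ψ) : SuppCard k (c • ψ) := by
  intro t ht
  rw [Pi.smul_apply, smul_eq_mul] at ht
  exact hψ t (right_ne_zero_of_mul ht)

/-- [folklore] -/
private theorem SuppCard.sum {k : ℤ} {ι : Type*} (S : Finset ι) (f : ι → Fock Mode)
    (h : ∀ i ∈ S, SuppCard k (f i)) : SuppCard k (∑ i ∈ S, f i) := by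
  classical
  induction S using Finset.induction_on with
  | empty => rw [Finset.sum_empty]; exact SuppCard.zero k
  | insert i S hi ih =>
    rw [Finset.sum_insert hi]
    exact (h i (mem_insert_self i S)).add (ih fun j hj => h j (mem_insert_of_mem hj))

/-- [folklore] -/
private theorem SuppCard.single (s : Finset Mode) : SuppCard (s.card : ℤ) (Pi.single s (1 : ℂ) : Fock Mode) := by
  intro t ht
  by_cases h : t = s
  · rw [h]
  · exact absurd (Pi.single_eq_of_ne h _) ht

/-- `c†_m` raises the particle number by one. [folklore] -/
private theorem SuppCard.creation_mulVec {k : ℤ} {ψ : Fock Mode} (m : Mode) (hψ : SuppCard k ψ) :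
    SuppCard (k + 1) (Literature.MathematicalPhysics.QuantumLattice.creation m *ᵥ ψ) := by
  intro t ht
  simp only [mulVec, dotProduct] at ht
  obtain ⟨s, -, hs⟩ := Finset.exists_ne_zero_of_sum_ne_zero ht
  have h1 : Literature.MathematicalPhysics.QuantumLattice.creation m t s ≠ 0 := left_ne_zero_of_mul hs
  have h2 : ψ s ≠ 0 := right_ne_zero_of_mul hs
  rw [creation_apply] at h1
  by_cases hc : m ∉ s ∧ t = insert m s
  · rw [hc.2, card_insert_of_notMem hc.1, ← hψ s h2]; push_cast; ring
  · exact absurd (if_neg hc) h1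

/-- `c_m` lowers the particle number by one. [folklore] -/
private theorem SuppCard.annihilation_mulVec {k : ℤ} {ψ : Fock Mode} (m : Mode) (hψ : SuppCard k ψ) :
    SuppCard (k - 1) (Literature.MathematicalPhysics.QuantumLattice.annihilation m *ᵥ ψ) := by
  intro t ht
  simp only [mulVec, dotProduct] at ht
  obtain ⟨s, -, hs⟩ := Finset.exists_ne_zero_of_sum_ne_zero ht
  have h1 : Literature.MathematicalPhysics.QuantumLattice.annihilation m t s ≠ 0 :=
    left_ne_zero_of_mul hs
  have h2 : ψ s ≠ 0 := right_ne_zero_of_mul hs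
  rw [annihilation_apply] at h1
  by_cases hc : m ∉ t ∧ s = insert m t
  · have := hψ s h2
    rw [hc.2, card_insert_of_notMem hc.1] at this
    push_cast at this
    linarith
  · exact absurd (if_neg hc) h1

/-- The charge of a generator: `+1` for `c†`, `-1` for `c`. [cite: Hastings2022, §2.1.1 (charge)] -/
def genCharge (γ : Mode × Bool) : ℤ := if γ.2 then 1 else -1

/-- The charge (change of particle number) of a monomial of degree `≤ 2`.
[cite: Hastings2022, §2.1.1 (charge)] -/
def charge : MonoIdx Mode → ℤ
  | none => 0
  | some (Sum.inl γ) => genCharge γ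
  | some (Sum.inr p) => genCharge p.1 + genCharge p.2

/-- A generator shifts the particle number by its charge. [folklore] -/
private theorem SuppCard.gen {k : ℤ} {ψ : Fock Mode} (γ : Mode × Bool) (hψ : SuppCard k ψ) :
    SuppCard (k + genCharge γ) (gen γ *ᵥ ψ) := by
  rcases γ with ⟨m, b⟩
  cases b
  · have h := hψ.annihilation_mulVec m
    rw [sub_eq_add_neg] at h
    exact h
  · exact hψ.creation_mulVec m

/-- A monomial shifts the particle number by its charge. [folklore] -/
private theorem SuppCard.mono {k : ℤ} {ψ : Fock Mode} (i : MonoIdx Mode) (hψ : SuppCard k ψ) :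
    SuppCard (k + charge i) (DegreeFourSos.mono i *ᵥ ψ) := by
  rcases i with _ | γ | ⟨γ, γ'⟩
  · simpa [DegreeFourSos.mono, charge] using hψ
  · simpa [DegreeFourSos.mono, charge] using hψ.gen γ
  · have h := (hψ.gen γ').gen γ
    simp only [DegreeFourSos.mono, charge, ← mulVec_mulVec]
    convert h using 1
    ring

/-- Vectors in different particle-number sectors are orthogonal. [folklore] -/
private theorem dotProduct_eq_zero_of_suppCard {k k' : ℤ} {ψ φ : Fock Mode} (hψ : SuppCard k ψ)
    (hφ : SuppCard k' φ) (hk : k ≠ k') : star ψ ⬝ᵥ φ = 0 := by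
  refine Finset.sum_eq_zero fun t _ => ?_
  by_cases h1 : ψ t = 0
  · simp [h1]
  · by_cases h2 : φ t = 0
    · simp [h2]
    · exact absurd ((hψ t h1).symm.trans (hφ t h2)) hk

/-- The range of charges of monomials of degree `≤ 2`. [folklore] -/
def chargeRange : Finset ℤ := {-2, -1, 0, 1, 2}

/-- [folklore] -/
private theorem genCharge_eq (γ : Mode × Bool) : genCharge γ = 1 ∨ genCharge γ = -1 := by
  unfold genCharge; split_ifs <;> simp

/-- [folklore] -/
private theorem charge_mem_chargeRange (i : MonoIdx Mode) : charge i ∈ chargeRange := by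
  rcases i with _ | γ | ⟨γ, γ'⟩
  · simp [charge, chargeRange]
  · rcases genCharge_eq γ with h | h <;> simp [charge, chargeRange, h]
  · rcases genCharge_eq γ with h | h <;> rcases genCharge_eq γ' with h' | h' <;>
      simp [charge, chargeRange, h, h']

/-- [folklore] -/
private theorem mem_chargeRange {q : ℤ} (h : q ∈ chargeRange) : -2 ≤ q ∧ q ≤ 2 := by
  simp only [chargeRange, mem_insert, mem_singleton] at h
  omega

/-- The charge-`q` part of a coefficient vector. [cite: Hastings2022, §2.1.1] -/
def cq (c : MonoIdx Mode → ℂ) (q : ℤ) : MonoIdx Mode → ℂ := fun i => if charge i = q then c i else 0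

/-- Decomposition of a degree-`≤ 2` polynomial into its charge components.
[cite: Hastings2022, §2.1.1] -/
theorem poly₂_eq_sum_cq (c : MonoIdx Mode → ℂ) :
    poly₂ c = ∑ q ∈ chargeRange, poly₂ (cq c q) := by
  simp only [poly₂, cq]
  rw [Finset.sum_comm]
  refine Finset.sum_congr rfl fun i _ => ?_
  simp only [ite_smul, zero_smul]
  rw [Finset.sum_ite_eq chargeRange (charge i) (fun _ => c i • DegreeFourSos.mono i),
    if_pos (charge_mem_chargeRange i)]

/-- The charge-`q` part maps `|s⟩` into the `(|s| + q)`-particle sector. [folklore] -/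
private theorem suppCard_poly₂_cq (c : MonoIdx Mode → ℂ) (q : ℤ) (s : Finset Mode) :
    SuppCard (s.card + q) (poly₂ (cq c q) *ᵥ (Pi.single s (1 : ℂ) : Fock Mode)) := by
  rw [poly₂, Matrix.sum_mulVec]
  refine SuppCard.sum _ _ fun i _ => ?_
  rw [Matrix.smul_mulVec, cq]
  by_cases h : charge i = q
  · rw [if_pos h, ← h]
    exact ((SuppCard.single s).mono i).smul _
  · rw [if_neg h, zero_smul]
    exact SuppCard.zero _

/-- In a sum of vectors from distinct particle-number sectors, the norm of one summand is bounded
by the norm of the sum. [folklore] -/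
private theorem star_dotProduct_self_le_of_suppCard (x : ℤ → Fock Mode) (base : ℤ)
    (h : ∀ q ∈ chargeRange, SuppCard (base + q) (x q)) {q₀ : ℤ} (hq₀ : q₀ ∈ chargeRange) :
    star (x q₀) ⬝ᵥ x q₀ ≤
      star (∑ q ∈ chargeRange, x q) ⬝ᵥ (∑ q ∈ chargeRange, x q) := by
  have hdiag : star (∑ q ∈ chargeRange, x q) ⬝ᵥ (∑ q ∈ chargeRange, x q) =
      ∑ q ∈ chargeRange, star (x q) ⬝ᵥ x q := by
    rw [star_sum, sum_dotProduct]
    refine Finset.sum_congr rfl fun q hq => ?_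
    rw [dotProduct_sum]
    refine Finset.sum_eq_single_of_mem q hq fun q' hq' hne => ?_
    exact dotProduct_eq_zero_of_suppCard (h q hq) (h q' hq') (by omega)
  rw [hdiag]
  exact Finset.single_le_sum (fun q _ => dotProduct_star_self_nonneg (x q)) hq₀

/-- **Charge selection for the `v`-term**: `⟨O∅, O Q⟩ = ⟨O₊₊ ∅, O₋₋ Q⟩` for a four-element `Q`
("If `q = ±4/3` or `q = 0`, then the pseudo-expectation value is independent of `v` … it suffices
to consider the case `±q = 2/3`"). [cite: Hastings2022, §2.1.1] -/
theorem cross_term_eq (c : MonoIdx Mode → ℂ) {Q : Finset Mode} (hQ : Q.card = 4) :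
    star (poly₂ c *ᵥ (Pi.single ∅ (1 : ℂ) : Fock Mode)) ⬝ᵥ (poly₂ c *ᵥ (Pi.single Q (1 : ℂ) : Fock Mode)) =
      star (poly₂ (cq c 2) *ᵥ (Pi.single ∅ (1 : ℂ) : Fock Mode)) ⬝ᵥ
        (poly₂ (cq c (-2)) *ᵥ (Pi.single Q (1 : ℂ) : Fock Mode)) := by
  have h0 := fun q => suppCard_poly₂_cq c q ∅
  have hQ' := fun q => suppCard_poly₂_cq c q Q
  simp only [card_empty, Nat.cast_zero, zero_add, hQ, Nat.cast_ofNat] at h0 hQ'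
  rw [poly₂_eq_sum_cq c, Matrix.sum_mulVec, Matrix.sum_mulVec, star_sum, sum_dotProduct]
  rw [Finset.sum_eq_single_of_mem (2 : ℤ) (by simp [chargeRange])]
  · rw [dotProduct_sum]
    rw [Finset.sum_eq_single_of_mem (-2 : ℤ) (by simp [chargeRange])]
    intro q' hq' hne
    exact dotProduct_eq_zero_of_suppCard (h0 2) (hQ' q') (by have := mem_chargeRange hq'; omega)
  · intro q hq hne
    rw [dotProduct_sum]
    refine Finset.sum_eq_zero fun q' hq' => ?_
    exact dotProduct_eq_zero_of_suppCard (h0 q) (hQ' q')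
      (by have := mem_chargeRange hq; have := mem_chargeRange hq'; omega)

/-- `‖O₋₋ F‖² ≤ ‖O F‖²` and `‖O₊₊ ∅‖² ≤ ‖O ∅‖²` (orthogonality of the charge components).
[cite: Hastings2022, §2.1.1] -/
theorem star_dotProduct_cq_le (c : MonoIdx Mode → ℂ) (s : Finset Mode) {q₀ : ℤ}
    (hq₀ : q₀ ∈ chargeRange) :
    star (poly₂ (cq c q₀) *ᵥ (Pi.single s (1 : ℂ) : Fock Mode)) ⬝ᵥ
        (poly₂ (cq c q₀) *ᵥ (Pi.single s (1 : ℂ) : Fock Mode)) ≤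
      star (poly₂ c *ᵥ (Pi.single s (1 : ℂ) : Fock Mode)) ⬝ᵥ
        (poly₂ c *ᵥ (Pi.single s (1 : ℂ) : Fock Mode)) := by
  have h := star_dotProduct_self_le_of_suppCard
    (fun q => poly₂ (cq c q) *ᵥ (Pi.single s (1 : ℂ) : Fock Mode)) s.card
    (fun q _ => suppCard_poly₂_cq c q s) hq₀
  rwa [← Matrix.sum_mulVec, ← poly₂_eq_sum_cq c] at h

/-! #### The explicit charge-`±2` parts -/

/-- `O₋₋ = Σ_{m,m'} c_{(m,c),(m',c)} ψ_m ψ_{m'}`. [cite: Hastings2022, §2.1.1 (the monomials N_{i,a}, R_{i,j})] -/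
theorem poly₂_cq_neg_two (c : MonoIdx Mode → ℂ) :
    poly₂ (cq c (-2)) = ∑ m : Mode, ∑ m' : Mode,
      c (some (Sum.inr ((m, false), (m', false)))) • (annihilation m * annihilation m') := by
  simp only [poly₂, cq, Fintype.sum_option, Fintype.sum_sum_type, Fintype.sum_prod_type,
    Fintype.sum_bool, charge, genCharge, DegreeFourSos.mono, gen]
  norm_num

/-- `O₊₊ = Σ_{m,m'} c_{(m,†),(m',†)} ψ†_m ψ†_{m'}`. [cite: Hastings2022, §2.1.1 (the monomials M_{i,a})] -/
theorem poly₂_cq_two (c : MonoIdx Mode → ℂ) :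
    poly₂ (cq c 2) = ∑ m : Mode, ∑ m' : Mode,
      c (some (Sum.inr ((m, true), (m', true)))) • (creation m * creation m') := by
  simp only [poly₂, cq, Fintype.sum_option, Fintype.sum_sum_type, Fintype.sum_prod_type,
    Fintype.sum_bool, charge, genCharge, DegreeFourSos.mono, gen]
  norm_num

/-! #### Removing the other quartet's private modes: the operator `D_a = ψ_{1,a'}ψ_{2,a'}ψ_{3,a'}` -/

/-- The private modes of the other quartet, listed. [folklore] -/
private theorem rest_eq (a : Fin 2) : rest a = {q (a + 1) 0, q (a + 1) 1, q (a + 1) 2} := by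
  fin_cases a <;> decide

/-- `D_a = ψ_{(1,a')} ψ_{(2,a')} ψ_{(3,a')}`, `a' ≠ a`: annihilates the other quartet's private modes.
[folklore] -/
def restAnnihilate (a : Fin 2) : Op7 :=
  annihilation (q (a + 1) 0) * (annihilation (q (a + 1) 1) * annihilation (q (a + 1) 2))

/-- The sign picked up by `D_a` on `|t⟩`. [folklore] -/
def restSign (a : Fin 2) (t : Finset Mode) : ℂ :=
  jwSign (q (a + 1) 2) t * jwSign (q (a + 1) 1) (t.erase (q (a + 1) 2)) *
    jwSign (q (a + 1) 0) ((t.erase (q (a + 1) 2)).erase (q (a + 1) 1))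

/-- `restSign` is real. [folklore] -/
private theorem star_restSign (a : Fin 2) (t : Finset Mode) : star (restSign a t) = restSign a t := by
  simp [restSign, star_jwSign, mul_comm]

/-- `restSign² = 1`. [folklore] -/
private theorem restSign_mul_self (a : Fin 2) (t : Finset Mode) : restSign a t * restSign a t = 1 := by
  have h := fun i s => jwSign_mul_self (ι := Mode) i s
  simp only [restSign]
  calc _ = (jwSign (q (a + 1) 2) t * jwSign (q (a + 1) 2) t) *
      (jwSign (q (a + 1) 1) (t.erase (q (a + 1) 2)) * jwSign (q (a + 1) 1) (t.erase (q (a + 1) 2))) *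
      (jwSign (q (a + 1) 0) ((t.erase (q (a + 1) 2)).erase (q (a + 1) 1)) *
        jwSign (q (a + 1) 0) ((t.erase (q (a + 1) 2)).erase (q (a + 1) 1))) := by ring
    _ = 1 := by rw [h, h, h]; ring

/-- One Jordan–Wigner annihilation step on a scaled basis vector. [folklore] -/
private theorem annihilation_mulVec_smul_single (i : Mode) (θ : ℂ) (t : Finset Mode) :
    annihilation i *ᵥ (θ • (Pi.single t (1 : ℂ) : Fock Mode)) =
      if i ∈ t then (θ * jwSign i t) • (Pi.single (t.erase i) (1 : ℂ) : Fock Mode) else 0 := by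
  rw [mulVec_smul, annihilation_mulVec_single]
  split_ifs
  · rw [smul_smul]
  · simp

/-- `D_a |t⟩ = ± |t ∖ rest a⟩` when `rest a ⊆ t`. [folklore] -/
private theorem restAnnihilate_mulVec_single_of_subset {a : Fin 2} {t : Finset Mode} (h : rest a ⊆ t) :
    restAnnihilate a *ᵥ (Pi.single t (1 : ℂ) : Fock Mode) =
      restSign a t • (Pi.single (t \ rest a) (1 : ℂ) : Fock Mode) := by
  have hm : ∀ i, q (a + 1) i ∈ t := fun i => h (by rw [rest_eq]; fin_cases i <;> simp)
  have h2 : q (a + 1) 2 ∈ t := hm 2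
  have h1 : q (a + 1) 1 ∈ t.erase (q (a + 1) 2) := mem_erase.2 ⟨q_ne_q _ (by decide), hm 1⟩
  have h0 : q (a + 1) 0 ∈ (t.erase (q (a + 1) 2)).erase (q (a + 1) 1) :=
    mem_erase.2 ⟨q_ne_q _ (by decide), mem_erase.2 ⟨q_ne_q _ (by decide), hm 0⟩⟩
  have hset : ((t.erase (q (a + 1) 2)).erase (q (a + 1) 1)).erase (q (a + 1) 0) = t \ rest a := by
    ext m; simp [rest_eq]; tauto
  rw [restAnnihilate, ← mulVec_mulVec, ← mulVec_mulVec,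
    ← one_smul ℂ (Pi.single t (1 : ℂ) : Fock Mode), annihilation_mulVec_smul_single, if_pos h2,
    annihilation_mulVec_smul_single, if_pos h1, annihilation_mulVec_smul_single, if_pos h0, hset,
    one_mul, restSign]

/-- `D_a |t⟩ = 0` when `rest a ⊄ t`. [folklore] -/
private theorem restAnnihilate_mulVec_single_of_not_subset {a : Fin 2} {t : Finset Mode} (h : ¬ rest a ⊆ t) :
    restAnnihilate a *ᵥ (Pi.single t (1 : ℂ) : Fock Mode) = 0 := by
  rw [restAnnihilate, ← mulVec_mulVec, ← mulVec_mulVec,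
    ← one_smul ℂ (Pi.single t (1 : ℂ) : Fock Mode), annihilation_mulVec_smul_single]
  by_cases h2 : q (a + 1) 2 ∈ t
  · rw [if_pos h2, annihilation_mulVec_smul_single]
    by_cases h1 : q (a + 1) 1 ∈ t.erase (q (a + 1) 2)
    · rw [if_pos h1, annihilation_mulVec_smul_single]
      by_cases h0 : q (a + 1) 0 ∈ (t.erase (q (a + 1) 2)).erase (q (a + 1) 1)
      · exfalso; apply h
        rw [rest_eq]
        intro m hm
        simp only [mem_insert, mem_singleton] at hm
        rcases hm with rfl | rfl | rfl
        · exact mem_of_mem_erase (mem_of_mem_erase h0)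
        · exact mem_of_mem_erase h1
        · exact h2
      · rw [if_neg h0]
    · rw [if_neg h1, mulVec_zero]
  · rw [if_neg h2, mulVec_zero, mulVec_zero]

/-- Matrix entries of `D_a`. [folklore] -/
private theorem restAnnihilate_apply (a : Fin 2) (t s : Finset Mode) :
    restAnnihilate a t s = if rest a ⊆ s ∧ t = s \ rest a then restSign a s else 0 := by
  have key : restAnnihilate a t s = (restAnnihilate a *ᵥ (Pi.single s (1 : ℂ) : Fock Mode)) t := by
    rw [mulVec_single_one]; rfl
  rw [key]
  by_cases hs : rest a ⊆ s
  · rw [restAnnihilate_mulVec_single_of_subset hs, Pi.smul_apply, smul_eq_mul]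
    by_cases ht : t = s \ rest a
    · subst ht; simp [hs]
    · rw [if_neg (fun h => ht h.2), Pi.single_eq_of_ne ht, mul_zero]
  · rw [restAnnihilate_mulVec_single_of_not_subset hs, if_neg (fun h => hs h.1), Pi.zero_apply]

/-- `D_a† D_a = n_{(1,a')} n_{(2,a')} n_{(3,a')}` = projection onto configurations containing
`rest a`. [folklore] -/
private theorem restAnnihilate_gram (a : Fin 2) :
    (restAnnihilate a)ᴴ * restAnnihilate a = diagonal fun t => if rest a ⊆ t then 1 else 0 := by
  ext t s
  rw [conjTranspose_mul_apply_eq_dotProduct, diagonal_apply]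
  by_cases hs : rest a ⊆ s
  · rw [restAnnihilate_mulVec_single_of_subset hs]
    by_cases ht : rest a ⊆ t
    · rw [restAnnihilate_mulVec_single_of_subset ht, star_smul, smul_dotProduct, dotProduct_smul,
        star_single_dotProduct_single, star_restSign, smul_eq_mul, smul_eq_mul]
      by_cases hts : t = s
      · subst hts; simp [restSign_mul_self, ht]
      · rw [if_neg, if_neg hts, mul_zero, mul_zero]
        intro h
        apply hts
        rw [← Finset.sdiff_union_of_subset ht, h, Finset.sdiff_union_of_subset hs]
    · rw [restAnnihilate_mulVec_single_of_not_subset ht, star_zero, zero_dotProduct]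
      have hts : t ≠ s := fun h => ht (h ▸ hs)
      rw [if_neg hts]
  · rw [restAnnihilate_mulVec_single_of_not_subset hs, dotProduct_zero]
    by_cases hts : t = s
    · subst hts; rw [if_pos rfl, if_neg hs]
    · rw [if_neg hts]

/-- `D_a |F⟩ = ± |Q_a⟩`. [folklore] -/
private theorem restAnnihilate_mulVec_single_univ (a : Fin 2) :
    restAnnihilate a *ᵥ (Pi.single univ (1 : ℂ) : Fock Mode) =
      restSign a univ • (Pi.single (quartet a) (1 : ℂ) : Fock Mode) := by
  rw [restAnnihilate_mulVec_single_of_subset (subset_univ _)]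
  congr 2
  ext m; simp [rest]

/-- `‖D_a φ‖² = Σ_{t ⊇ rest a} |φ(t)|²`. [folklore] -/
private theorem star_dotProduct_restAnnihilate_mulVec (a : Fin 2) (φ : Fock Mode) :
    star (restAnnihilate a *ᵥ φ) ⬝ᵥ (restAnnihilate a *ᵥ φ) =
      ∑ t, if rest a ⊆ t then star (φ t) * φ t else 0 := by
  rw [star_mulVec, ← dotProduct_mulVec, mulVec_mulVec, restAnnihilate_gram]
  simp only [dotProduct, mulVec_diagonal, Pi.star_apply]
  refine Finset.sum_congr rfl fun t _ => ?_
  split_ifs <;> simp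

/-- `(D_a φ)(t) ≠ 0 ⇒ t` misses `rest a`. [folklore] -/
private theorem disjoint_of_restAnnihilate_mulVec_ne_zero {a : Fin 2} {φ : Fock Mode} {t : Finset Mode}
    (h : (restAnnihilate a *ᵥ φ) t ≠ 0) : Disjoint (rest a) t := by
  simp only [mulVec, dotProduct] at h
  obtain ⟨s, -, hs⟩ := Finset.exists_ne_zero_of_sum_ne_zero h
  have h1 : restAnnihilate a t s ≠ 0 := left_ne_zero_of_mul hs
  rw [restAnnihilate_apply] at h1
  by_cases hc : rest a ⊆ s ∧ t = s \ rest a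
  · rw [hc.2]; exact disjoint_sdiff
  · exact absurd (if_neg hc) h1

/-- `c_i c_j = - c_j c_i`. [folklore] -/
private theorem annihilation_swap (i j : Mode) :
    annihilation i * annihilation j = -(annihilation j * annihilation i) :=
  eq_neg_of_add_eq_zero_left (annihilation_anticommute_holds (ι := Mode) i j)

/-- `ψ_m D_a = - D_a ψ_m`. [folklore] -/
private theorem annihilation_mul_restAnnihilate (m : Mode) (a : Fin 2) :
    annihilation m * restAnnihilate a = -(restAnnihilate a * annihilation m) := by
  set c0 := annihilation (q (a + 1) 0)
  set c1 := annihilation (q (a + 1) 1)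
  set c2 := annihilation (q (a + 1) 2)
  set cm := annihilation m
  simp only [restAnnihilate]
  calc cm * (c0 * (c1 * c2)) = (cm * c0) * (c1 * c2) := by rw [← mul_assoc]
    _ = -(c0 * (cm * (c1 * c2))) := by rw [annihilation_swap m, neg_mul, mul_assoc]
    _ = -(c0 * ((cm * c1) * c2)) := by rw [← mul_assoc cm]
    _ = c0 * (c1 * (cm * c2)) := by rw [annihilation_swap m, neg_mul, mul_neg, neg_neg, mul_assoc]
    _ = -(c0 * (c1 * (c2 * cm))) := by rw [annihilation_swap m, mul_neg, mul_neg]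
    _ = -(c0 * (c1 * c2) * cm) := by rw [mul_assoc, mul_assoc]

/-- `(ψ_m ψ_{m'}) D_a = D_a (ψ_m ψ_{m'})` (an even element commutes past `D_a`). [folklore] -/
private theorem pair_mul_restAnnihilate (m m' : Mode) (a : Fin 2) :
    annihilation m * annihilation m' * restAnnihilate a =
      restAnnihilate a * (annihilation m * annihilation m') := by
  rw [mul_assoc, annihilation_mul_restAnnihilate, mul_neg, ← mul_assoc,
    annihilation_mul_restAnnihilate, neg_mul, neg_neg, mul_assoc]

/-- `O₋₋ D_a = D_a O₋₋`. [folklore] -/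
private theorem poly₂_cq_neg_two_mul_restAnnihilate (c : MonoIdx Mode → ℂ) (a : Fin 2) :
    poly₂ (cq c (-2)) * restAnnihilate a = restAnnihilate a * poly₂ (cq c (-2)) := by
  rw [poly₂_cq_neg_two, Finset.sum_mul, Finset.mul_sum]
  refine Finset.sum_congr rfl fun m _ => ?_
  rw [Finset.sum_mul, Finset.mul_sum]
  refine Finset.sum_congr rfl fun m' _ => ?_
  rw [smul_mul_assoc, mul_smul_comm, pair_mul_restAnnihilate]

/-- **`β_a = ± D_a γ`**: the `ψψ`-part acting on `Ψ_a` is `D_a` applied to the `ψψ`-part acting on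
the full configuration. [folklore] -/
private theorem poly₂_cq_neg_two_mulVec_quartet (c : MonoIdx Mode → ℂ) (a : Fin 2) :
    poly₂ (cq c (-2)) *ᵥ (Pi.single (quartet a) (1 : ℂ) : Fock Mode) =
      restSign a univ • (restAnnihilate a *ᵥ
        (poly₂ (cq c (-2)) *ᵥ (Pi.single univ (1 : ℂ) : Fock Mode))) := by
  have hQ : (Pi.single (quartet a) (1 : ℂ) : Fock Mode) =
      restSign a univ • (restAnnihilate a *ᵥ (Pi.single univ (1 : ℂ) : Fock Mode)) := by
    rw [restAnnihilate_mulVec_single_univ, smul_smul, restSign_mul_self, one_smul]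
  rw [hQ, mulVec_smul, mulVec_mulVec, poly₂_cq_neg_two_mul_restAnnihilate, ← mulVec_mulVec]

/-! #### Cardinality facts -/

/-- `|Q_a| = 4`. [folklore] -/
private theorem card_quartet (a : Fin 2) : (quartet a).card = 4 := by
  fin_cases a <;> decide

/-- `rest 0 ∪ rest 1 = {all modes} ∖ {0}`, of cardinality `6`. [folklore] -/
private theorem six_le_card_of_rest_subset {t : Finset Mode} (h0 : rest 0 ⊆ t) (h1 : rest 1 ⊆ t) :
    6 ≤ t.card := by
  have h : rest 0 ∪ rest 1 ⊆ t := union_subset h0 h1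
  have hc : (rest 0 ∪ rest 1).card = 6 := by decide
  exact hc ▸ card_le_card h

/-- A configuration missing both `rest 0` and `rest 1` has at most one mode. [folklore] -/
private theorem card_le_one_of_disjoint_rest {t : Finset Mode} (h0 : Disjoint (rest 0) t)
    (h1 : Disjoint (rest 1) t) : t.card ≤ 1 := by
  have h : t ⊆ {0} := by
    intro m hm
    have hm0 : m ∉ rest 0 := fun h' => Finset.disjoint_left.1 h0 h' hm
    have hm1 : m ∉ rest 1 := fun h' => Finset.disjoint_left.1 h1 h' hm
    have key : ∀ m : Mode, m ∉ rest 0 → m ∉ rest 1 → m = 0 := by decide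
    exact mem_singleton.2 (key m hm0 hm1)
  exact (card_le_card h).trans (by simp)

/-! #### Norms as real sums; Cauchy–Schwarz -/

/-- `⟨x, x⟩ = Σ |x_t|²`. [folklore] -/
private theorem star_dotProduct_self_eq (x : Fock Mode) :
    star x ⬝ᵥ x = ((∑ t, ‖x t‖ ^ 2 : ℝ) : ℂ) := by
  simp only [dotProduct, Pi.star_apply, Complex.star_def, Complex.conj_mul']
  push_cast
  rfl

/-- Cauchy–Schwarz for the Hermitian dot product. [folklore] -/
private theorem norm_star_dotProduct_le (x y : Fock Mode) :
    ‖star x ⬝ᵥ y‖ ≤ √(∑ t, ‖x t‖ ^ 2) * √(∑ t, ‖y t‖ ^ 2) := by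
  calc ‖star x ⬝ᵥ y‖ = ‖∑ t, star (x t) * y t‖ := rfl
    _ ≤ ∑ t, ‖star (x t) * y t‖ := norm_sum_le _ _
    _ = ∑ t, ‖x t‖ * ‖y t‖ := by simp
    _ ≤ _ := Real.sum_mul_le_sqrt_mul_sqrt _ _ _

/-- The `2 × 2` positivity `[[1-u, v],[v, u]] ⪰ 0` in the form used below. [cite: Hastings2022, §2.1.1 (the two-by-two matrix)] -/
theorem two_by_two_nonneg {u v x y : ℝ} (hu0 : 0 ≤ u) (huv : v ^ 2 ≤ u * (1 - u)) :
    2 * |v| * (x * y) ≤ (1 - u) * x ^ 2 + u * y ^ 2 := by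
  rcases hu0.eq_or_lt with h | hu
  · rw [← h] at huv ⊢
    have hv : v = 0 := by nlinarith [sq_nonneg v]
    rw [hv]; simp; positivity
  · have hw : |v| ^ 2 ≤ u * (1 - u) := by rwa [sq_abs]
    have key : 0 ≤ u * ((1 - u) * x ^ 2 + u * y ^ 2 - 2 * |v| * (x * y)) := by
      have : u * ((1 - u) * x ^ 2 + u * y ^ 2 - 2 * |v| * (x * y)) =
          (u * y - |v| * x) ^ 2 + (u * (1 - u) - |v| ^ 2) * x ^ 2 := by ring
      rw [this]
      have : 0 ≤ (u * (1 - u) - |v| ^ 2) * x ^ 2 := mul_nonneg (sub_nonneg.2 hw) (sq_nonneg x)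
      positivity
    have := (mul_nonneg_iff_of_pos_left hu).1 key
    linarith

/-! #### Assembly of degree-4 positivity -/

/-- **Degree-4 positivity of Hastings's pseudo-expectation**: for `0 ≤ u ≤ 1` and
`v² ≤ u(1-u)`, `Ẽ_{u,v}[O†O] ≥ 0` for every `O` of degree `≤ 2`.
[cite: Hastings2022, §2.1.1 ("we must verify positive definiteness in the case that v ≠ 0")] -/
theorem pseudoE_conjTranspose_mul_self_nonneg {u v : ℝ} (hu0 : 0 ≤ u) (hu1 : u ≤ 1)
    (huv : v ^ 2 ≤ u * (1 - u)) (c : MonoIdx Mode → ℂ) :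
    0 ≤ pseudoE u v ((poly₂ c)ᴴ * poly₂ c) := by
  -- notation
  set O := poly₂ c with hO
  set α : Fock Mode := poly₂ (cq c 2) *ᵥ (Pi.single ∅ (1 : ℂ) : Fock Mode) with hα
  set γ : Fock Mode := poly₂ (cq c (-2)) *ᵥ (Pi.single univ (1 : ℂ) : Fock Mode) with hγ
  set β : Fin 2 → Fock Mode :=
    fun a => poly₂ (cq c (-2)) *ᵥ (Pi.single (quartet a) (1 : ℂ) : Fock Mode) with hβ
  -- the four entries
  have hcross : ∀ a, (Oᴴ * O) ∅ (quartet a) = star α ⬝ᵥ β a := fun a => by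
    rw [conjTranspose_mul_apply_eq_dotProduct, hO, cross_term_eq c (card_quartet a)]
  have hcross' : ∀ a, (Oᴴ * O) (quartet a) ∅ = star (star α ⬝ᵥ β a) := fun a => by
    rw [← hcross, ← conjTranspose_apply, conjTranspose_mul, conjTranspose_conjTranspose]
  -- real quantities
  set A : ℝ := ∑ t, ‖(O *ᵥ (Pi.single ∅ (1 : ℂ) : Fock Mode)) t‖ ^ 2 with hA
  set B : ℝ := ∑ t, ‖(O *ᵥ (Pi.single univ (1 : ℂ) : Fock Mode)) t‖ ^ 2 with hB
  set A₂ : ℝ := ∑ t, ‖α t‖ ^ 2 with hA₂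
  set B₂ : ℝ := ∑ t, ‖γ t‖ ^ 2 with hB₂
  set xs : Fin 2 → ℝ := fun a => ∑ t, if Disjoint (rest a) t then ‖α t‖ ^ 2 else 0 with hxs
  set ys : Fin 2 → ℝ := fun a => ∑ t, ‖β a t‖ ^ 2 with hys
  set z : Fin 2 → ℂ := fun a => star α ⬝ᵥ β a with hz
  -- Ẽ[O†O] as a real number
  have hsum : (∑ a, ((Oᴴ * O) ∅ (quartet a) + (Oᴴ * O) (quartet a) ∅)) =
      ((∑ a, 2 * (z a).re : ℝ) : ℂ) := by
    push_cast
    refine Finset.sum_congr rfl fun a _ => ?_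
    rw [hcross, hcross', Complex.star_def, Complex.add_conj]
    push_cast
    ring
  have hval : pseudoE u v (Oᴴ * O) = (((1 - u) * A + u * B + v * ∑ a, 2 * (z a).re : ℝ) : ℂ) := by
    rw [pseudoE_eq, hsum, conjTranspose_mul_apply_eq_dotProduct O ∅ ∅,
      conjTranspose_mul_apply_eq_dotProduct O univ univ, star_dotProduct_self_eq,
      star_dotProduct_self_eq, ← hA, ← hB]
    push_cast
    ring
  rw [hval, Complex.zero_le_real]
  -- (1) A ≥ A₂, B ≥ B₂
  have hAA : A₂ ≤ A := by
    have h := star_dotProduct_cq_le c ∅ (q₀ := 2) (by simp [chargeRange])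
    rw [star_dotProduct_self_eq, star_dotProduct_self_eq, Complex.real_le_real] at h
    exact h
  have hBB : B₂ ≤ B := by
    have h := star_dotProduct_cq_le c univ (q₀ := -2) (by simp [chargeRange])
    rw [star_dotProduct_self_eq, star_dotProduct_self_eq, Complex.real_le_real] at h
    exact h
  -- (2) Σ_a ys a ≤ B₂
  have hγsupp : SuppCard 5 γ := by
    have h := suppCard_poly₂_cq c (-2) univ
    have h5 : ((Finset.univ : Finset Mode).card : ℤ) + -2 = 5 := by simp
    rw [h5] at h
    exact h
  have hys_eq : ∀ a, ys a = ∑ t, if rest a ⊆ t then ‖γ t‖ ^ 2 else 0 := fun a => by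
    have h1 : star (β a) ⬝ᵥ β a = ∑ t, if rest a ⊆ t then star (γ t) * γ t else 0 := by
      simp only [hβ]
      rw [poly₂_cq_neg_two_mulVec_quartet, star_smul, smul_dotProduct, dotProduct_smul, smul_smul,
        star_restSign, restSign_mul_self, one_smul, star_dotProduct_restAnnihilate_mulVec]
    rw [star_dotProduct_self_eq] at h1
    have h2 : (∑ t, if rest a ⊆ t then star (γ t) * γ t else 0) =
        (((∑ t, if rest a ⊆ t then ‖γ t‖ ^ 2 else 0 : ℝ)) : ℂ) := by
      push_cast
      refine Finset.sum_congr rfl fun t _ => ?_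
      split_ifs <;> simp [Complex.conj_mul']
    rw [h2] at h1
    exact_mod_cast h1
  have hyB : ∑ a, ys a ≤ B₂ := by
    rw [Fin.sum_univ_two, hys_eq, hys_eq, hB₂, ← Finset.sum_add_distrib]
    refine Finset.sum_le_sum fun t _ => ?_
    by_cases hγt : γ t = 0
    · simp [hγt]
    · have h5 := hγsupp t hγt
      by_cases h0 : rest 0 ⊆ t <;> by_cases h1 : rest 1 ⊆ t
      · exfalso
        have := six_le_card_of_rest_subset h0 h1
        omega
      · simp [h0, h1]
      · simp [h0, h1]
      · simp [h0, h1]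
  -- (3) Σ_a xs a ≤ A₂
  have hαsupp : SuppCard 2 α := by
    have h := suppCard_poly₂_cq c 2 ∅
    simp only [card_empty, Nat.cast_zero, zero_add] at h
    exact h
  have hxA : ∑ a, xs a ≤ A₂ := by
    rw [Fin.sum_univ_two, hxs, hA₂]
    simp only
    rw [← Finset.sum_add_distrib]
    refine Finset.sum_le_sum fun t _ => ?_
    by_cases hαt : α t = 0
    · simp [hαt]
    · have h2 := hαsupp t hαt
      by_cases h0 : Disjoint (rest 0) t <;> by_cases h1 : Disjoint (rest 1) t
      · exfalso
        have := card_le_one_of_disjoint_rest h0 h1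
        omega
      · simp [h0, h1]
      · simp [h0, h1]
      · simp [h0, h1]
  -- (4) |z a| ≤ √(xs a) √(ys a)
  have hz_le : ∀ a, ‖z a‖ ≤ √(xs a) * √(ys a) := fun a => by
    set α' : Fock Mode := fun t => if Disjoint (rest a) t then α t else 0 with hα'
    have hzz : z a = star α' ⬝ᵥ β a := by
      change star α ⬝ᵥ β a = star α' ⬝ᵥ β a
      unfold dotProduct
      refine Finset.sum_congr rfl fun t _ => ?_
      simp only [Pi.star_apply, hα']
      by_cases hβt : β a t = 0
      · simp [hβt]
      · have hd : Disjoint (rest a) t := by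
          have : β a t = (restSign a univ • (restAnnihilate a *ᵥ γ)) t := by
            simp only [hβ, hγ]; rw [poly₂_cq_neg_two_mulVec_quartet]
          rw [this, Pi.smul_apply, smul_eq_mul] at hβt
          exact disjoint_of_restAnnihilate_mulVec_ne_zero (right_ne_zero_of_mul hβt)
        rw [if_pos hd]
    have hn : (∑ t, ‖α' t‖ ^ 2) = xs a := by
      simp only [hxs, hα']
      refine Finset.sum_congr rfl fun t _ => ?_
      split_ifs <;> simp
    rw [hzz, ← hn]
    exact norm_star_dotProduct_le α' (β a)
  -- (5) conclude
  have hre : ∀ a, |(z a).re| ≤ √(xs a) * √(ys a) := fun a =>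
    (Complex.abs_re_le_norm (z a)).trans (hz_le a)
  have hterm : ∀ a, 2 * |v| * (√(xs a) * √(ys a)) ≤ (1 - u) * xs a + u * ys a := fun a => by
    have hx0 : 0 ≤ xs a := Finset.sum_nonneg fun t _ => by split_ifs <;> positivity
    have hy0 : 0 ≤ ys a := Finset.sum_nonneg fun t _ => by positivity
    have h := two_by_two_nonneg (x := √(xs a)) (y := √(ys a)) hu0 huv
    rwa [Real.sq_sqrt hx0, Real.sq_sqrt hy0] at h
  have hvz : ∀ a, -(2 * |v| * (√(xs a) * √(ys a))) ≤ v * (2 * (z a).re) := fun a => by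
    have h1 := hre a
    have h2 : |v * (2 * (z a).re)| ≤ 2 * |v| * (√(xs a) * √(ys a)) := by
      rw [abs_mul, abs_mul, abs_two]
      nlinarith [abs_nonneg v, abs_nonneg (z a).re]
    exact neg_le_of_abs_le h2
  have hsum : -(∑ a, 2 * |v| * (√(xs a) * √(ys a))) ≤ v * ∑ a, 2 * (z a).re := by
    rw [Finset.mul_sum, ← Finset.sum_neg_distrib]
    exact Finset.sum_le_sum fun a _ => hvz a
  have h1u : 0 ≤ 1 - u := sub_nonneg.2 hu1
  calc (0 : ℝ) ≤ ∑ a, ((1 - u) * xs a + u * ys a - 2 * |v| * (√(xs a) * √(ys a))) :=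
        Finset.sum_nonneg fun a _ => sub_nonneg.2 (hterm a)
    _ = (1 - u) * ∑ a, xs a + u * ∑ a, ys a - ∑ a, 2 * |v| * (√(xs a) * √(ys a)) := by
        rw [Finset.mul_sum, Finset.mul_sum, ← Finset.sum_add_distrib, ← Finset.sum_sub_distrib]
    _ ≤ (1 - u) * A + u * B + v * ∑ a, 2 * (z a).re := by
        nlinarith [mul_le_mul_of_nonneg_left (hxA.trans hAA) h1u,
          mul_le_mul_of_nonneg_left (hyB.trans hBB) hu0, hsum]

/-- **Hastings's `Ẽ_{u,v}` is a degree-4 pseudo-expectation** for `0 ≤ u ≤ 1`, `v² ≤ u(1-u)`.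
[cite: Hastings2022, §2.1.1] -/
theorem isDegreeFourPseudoExpectation_pseudoE {u v : ℝ} (hu0 : 0 ≤ u) (hu1 : u ≤ 1)
    (huv : v ^ 2 ≤ u * (1 - u)) : IsDegreeFourPseudoExpectation (pseudoE u v) :=
  ⟨pseudoE_one u v, pseudoE_conjTranspose u v, pseudoE_conjTranspose_mul_self_nonneg hu0 hu1 huv⟩

/-! ### Consequences for the ground-state energy -/

/-- A positive-semidefinite lower bound is a ground-energy lower bound: `A + c·1 ⪰ 0 ⇒ -c ≤ E₀(A)`
(evaluate in the tracial ground state of `A`). [folklore] -/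
private theorem neg_le_groundEnergy_of_posSemidef_add {n : Type*} [Fintype n] [DecidableEq n] [Nonempty n]
    {A : Matrix n n ℂ} (hA : A.IsHermitian) {c : ℝ}
    (h : (A + (c : ℂ) • (1 : Matrix n n ℂ)).PosSemidef) : -c ≤ A.groundEnergy := by
  have h0 := Matrix.groundStateFunctional_nonneg_of_posSemidef A h
  rw [map_add, LinearMap.map_smul_of_tower, Matrix.groundStateFunctional_hamiltonian hA,
    Matrix.groundStateFunctional_one hA] at h0
  obtain ⟨hre, -⟩ := Complex.nonneg_iff.mp h0
  simp only [Complex.add_re, Complex.ofReal_re, smul_eq_mul, mul_one] at hre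
  linarith

/-- The ground-state energy of `H_ε` is at least `-ε²/2` (`0 ≤ ε ≤ 1`).
[cite: Hastings2022, §2.1.1 ("E₀ = -ε²/2 + O(ε⁴)")] -/
theorem groundEnergy_ge {ε : ℝ} (h0 : 0 ≤ ε) (h1 : ε ≤ 1) :
    -(ε ^ 2 / 2) ≤ (hamiltonian ε).groundEnergy :=
  neg_le_groundEnergy_of_posSemidef_add (hamiltonian_isHermitian ε) (hamiltonian_add_posSemidef h0 h1)

/-- The pseudo-energy lies strictly below `-ε²/2` for `0 < ε ≤ 1/2` (indeed for `ε² < 343/448`).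
[cite: Hastings2022, §2.1.1 ("since 4/7 > 1/2, this does not agree with the exact second order result")] -/
theorem pseudoEnergy_lt {ε : ℝ} (h0 : 0 < ε) (h1 : ε ≤ 1 / 2) :
    -(4 / 7) * ε ^ 2 + 32 / 343 * ε ^ 4 < -(ε ^ 2 / 2) := by
  have h2 : ε ^ 2 ≤ 1 / 4 := by nlinarith
  have h4 : ε ^ 4 ≤ ε ^ 2 * (1 / 4) := by nlinarith [sq_nonneg ε]
  nlinarith [pow_pos h0 2]

end DegreeFourSos

open DegreeFourSos

/-- **BARRIER `DegreeFourSosMissesSecondOrderPerturbation` (Hastings 2022, §2.1).**  For Hastings's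
seven-mode charge-conserving quartic fermion Hamiltonian in its particle–hole frame,
`H_ε = Σ_modes ψ†ψ + ε Σ_{a=1,2} (ψ†_0ψ†_{1,a}ψ†_{2,a}ψ†_{3,a} + h.c.)` (eq. (Hph)), and every
`0 < ε ≤ 1/2`: (1) there is a degree-4 pseudo-expectation `Ẽ` (normalised, Hermitian, nonnegative on
`O†O` for all `O` of degree `≤ 2` in the creation/annihilation operators) with
`Ẽ[H_ε] = -(4/7)ε² + (32/343)ε⁴`; (2) every state has energy `≥ -ε²/2`
(`H_ε + (ε²/2)·1 ⪰ 0`, so `E₀(H_ε) ≥ -ε²/2`); (3) `Ẽ[H_ε] < -ε²/2`; hence (4) NO degree-4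
sum-of-squares certificate `H_ε - λ = Σ_j O_j†O_j` (deg `O_j ≤ 2`) certifies any `λ > Ẽ[H_ε]`: the
degree-4 (= "2-RDM") lower bound misses the true ground-state energy by at least `ε²/14 - (32/343)ε⁴`,
i.e. it has the wrong second-order coefficient (`-4/7` vs `-1/2`): "degree-4 SoS (called 2-RDM in
quantum chemistry) does not reproduce second order perturbation theory".

technique_class: degree-4 non-commutative sum-of-squares / moment relaxations for fermionic Hamiltonians with quartic interactions — lower bounds on the ground-state energy certified by `H - λ = Σ O_j†O_j` with `deg O_j ≤ 2`, equivalently by pseudo-expectations (moment matrices) on words of degree `≤ 4` in `ψ, ψ†`; in quantum chemistry "the reduced density matrix (RDM) method" at the `2`-RDM level [cite: Hastings2022, Abstract and §1].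
blocks: the expectation that a `2`-body (degree-4, `2`-RDM-level) semidefinite relaxation is asymptotically exact at weak coupling — for this summit's programme: certified energy windows for interacting fermions (Hubbard-type quartic interactions) from degree-4 moment matrices / `2`-positivity ALONE cannot in general have the correct `O(ε²)` coefficient; a certified window of relative width `o(ε²)` in a perturbative regime needs degree `≥ 6` input [cite: Hastings2022, §1 ("which degree of SoS can correctly reproduce a given order of perturbation theory?") and §2.1].
because: an explicit degree-4 pseudo-expectation (`pseudoE (uOf ε) (vOf ε)`: `Ẽ[n_m] = Ẽ[n_m n_{m'}] = u`, `Ẽ[ψ†_0ψ†_{1,a}ψ†_{2,a}ψ†_{3,a}] = v`, `u = v² + 2v⁴`, `v = -2ε/7`) is feasible — positivity reduces, by charge conservation, to the `2 × 2` matrix `[[1-u, v],[v, u]] ⪰ 0` [cite: Hastings2022, §2.1.1] — and has pseudo-energy `4εv + 7u = -(4/7)ε² + O(ε⁴)`, while the exact ground-state energy is `-ε²/2 + O(ε⁴)` [cite: Hastings2022, §2.1.1]; by weak duality every degree-4 SoS certificate lies below every degree-4 pseudo-expectation (`DegreeFourSos.sosCertificate_le_pseudoExpectation`). Here (2) is proved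 as the operator inequality `H_ε ⪰ -ε²/2` for `0 ≤ ε ≤ 1` by an explicit decomposition (this file, `DegreeFourSos.hamiltonian_add_posSemidef`), in place of the exact `3 × 3` diagonalisation of print.
evasions_known: (i) degree-6 SoS (`3`-RDM), and already the FRAGMENT of degree-6 identified in §2.2 (terms `ψ†ψ†ψ†`/`ψψψ`-type words; cf. the `T1`/`T2′` partial `3`-positivity conditions of quantum chemistry), DOES reproduce second-order perturbation theory [cite: Hastings2022, §2.2]; in the tree the `T1, T2′` relaxation is `Literature.MathematicalPhysics.QuantumChemistry.ThreeIndexRelaxationBound` (soundness `le_groundEnergy_of_forall_isDQGT1T2PrimeFeasible`); (ii) the statement is about ASYMPTOTIC exactness at weak coupling — it does not prevent a degree-4 certificate from being numerically useful, nor from being tight for special (e.g. quadratic or frustration-free) Hamiltonians; (iii) adding problem-specific constraints beyond positivity (symmetries, exact sum rules, cluster/Anderson inputs) is outside the class.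
scope_caveats: ONE explicit seven-mode example (eq. (Hph), §2.1.1, number constraints NOT imposed); the eight-mode variant of §2.1.2 that also satisfies `Ẽ[n²] = Ẽ[n]² = n_e²` (the fixed-particle-number `2`-RDM setting of `Literature.MathematicalPhysics.QuantumChemistry.VariationalRDMRelaxation`, `le_groundEnergy_of_forall_isDQGFeasible`) is printed but NOT formalised here; print says "in general" on the strength of this example and does not claim failure for every quartic Hamiltonian; the constants here (`ε ≤ 1/2`, `u = v² + 2v⁴`, the bound `-ε²/2` in place of `2 - √(4 + 2ε²)`) are this file's explicit choices realising the printed `O(·)` statements; nothing is asserted about spin systems or bosons (print: degree-4 suffices at second order for qudits on general graphs, §3) — none of this weakens clauses (1)–(4).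
status: established (theorem `DegreeFourSosMissesSecondOrderPerturbation_holds` below; printed statement [cite: Hastings2022, Abstract, §1, §2.1.1]).
[cite: Hastings2022, §2.1.1] -/
def DegreeFourSosMissesSecondOrderPerturbation : Prop :=
  ∀ ε : ℝ, 0 < ε → ε ≤ 1 / 2 →
    (∃ E : Op7 →ₗ[ℂ] ℂ, IsDegreeFourPseudoExpectation E ∧
        E (DegreeFourSos.hamiltonian ε) = ((-(4 / 7) * ε ^ 2 + 32 / 343 * ε ^ 4 : ℝ) : ℂ)) ∧
    (DegreeFourSos.hamiltonian ε + ((ε ^ 2 / 2 : ℝ) : ℂ) • (1 : Op7)).PosSemidef ∧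
    -(ε ^ 2 / 2) ≤ (DegreeFourSos.hamiltonian ε).groundEnergy ∧
    -(4 / 7) * ε ^ 2 + 32 / 343 * ε ^ 4 < -(ε ^ 2 / 2) ∧
    ∀ lam : ℝ, IsDegreeFourSosCertificate (DegreeFourSos.hamiltonian ε) lam →
      lam ≤ -(4 / 7) * ε ^ 2 + 32 / 343 * ε ^ 4

/-- **Proof of the barrier** (everything above assembled). [cite: Hastings2022, §2.1.1] -/
theorem DegreeFourSosMissesSecondOrderPerturbation_holds : DegreeFourSosMissesSecondOrderPerturbation := by
  intro ε h0 h1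
  have h1' : ε ≤ 1 := h1.trans (by norm_num)
  obtain ⟨hu0, hu1, huv⟩ := uOf_vOf_window h0.le h1'
  have hE := isDegreeFourPseudoExpectation_pseudoE hu0 hu1 huv
  refine ⟨⟨pseudoE (uOf ε) (vOf ε), hE, pseudoE_hamiltonian_val ε⟩, hamiltonian_add_posSemidef h0.le h1',
    groundEnergy_ge h0.le h1', pseudoEnergy_lt h0 h1, fun lam hlam => ?_⟩
  have h := sosCertificate_le_pseudoExpectation hE hlam
  rw [pseudoE_hamiltonian_val, Complex.real_le_real] at h
  exact h

/-- Corollary in words: for `0 < ε ≤ 1/2` every degree-4 SoS-certified lower bound `λ` on `H_ε`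
misses the ground-state energy by at least `ε²/14 - (32/343)ε⁴ > 0`.
[cite: Hastings2022, §2.1.1] -/
theorem degreeFour_certificate_gap {ε lam : ℝ} (h0 : 0 < ε) (h1 : ε ≤ 1 / 2)
    (hlam : IsDegreeFourSosCertificate (DegreeFourSos.hamiltonian ε) lam) :
    lam + (ε ^ 2 / 14 - 32 / 343 * ε ^ 4) ≤ (DegreeFourSos.hamiltonian ε).groundEnergy := by
  obtain ⟨-, -, hge, -, hcert⟩ := DegreeFourSosMissesSecondOrderPerturbation_holds ε h0 h1
  have := hcert lam hlam
  linarith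

end Literature.Barriers.HubbardSuperconductivity

end
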